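import Summits.AtomisticToContinuum.BoseEinsteinCondensation.Theorems.BECTangentRigidityRigidMomentumBoundSmearingReduction
import Literature.MathematicalPhysics.QuantumManyBody.BoseGasThermodynamicLimitProofs
import Literature.MathematicalPhysics.QuantumManyBody.BoseGasDirichletWall
import Summits.AtomisticToContinuum.BoseEinsteinCondensation.Theorems.BECTangentRigidityRigidMomentumBoundStubSlopeChain
import Summits.AtomisticToContinuum.BoseEinsteinCondensation.Theorems.BECTangentRigidityRigidMomentumBoundStubShrinkBound
import Summits.AtomisticToContinuum.BoseEinsteinCondensation.Theorems.BECTangentRigidityRigidMomentumBoundStubWeightedGroupFloor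
import Summits.AtomisticToContinuum.BoseEinsteinCondensation.Theorems.BECTangentRigidityRigidMomentumBoundStubBoxEnergyRightContinuous
import Summits.AtomisticToContinuum.BoseEinsteinCondensation.Theorems.BECTangentRigidityRigidMomentumBoundStubFirstVariation
import Summits.AtomisticToContinuum.BoseEinsteinCondensation.Theorems.BECTangentRigidityRigidMomentumBoundStubSturmPackage
import Summits.AtomisticToContinuum.BoseEinsteinCondensation.Theorems.BECTangentRigidityRigidMomentumBoundStubFullSliceEnergy1D
import Summits.AtomisticToContinuum.BoseEinsteinCondensation.Theorems.BECTangentRigidityRigidMomentumBoundStubInsertionBound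
import Summits.AtomisticToContinuum.BoseEinsteinCondensation.Theorems.BECTangentRigidityRigidMomentumBoundStubEnergyCauchy
import Summits.AtomisticToContinuum.BoseEinsteinCondensation.Theorems.BECTangentRigidityRigidMomentumBoundStubSlicePackageFinite
import Summits.AtomisticToContinuum.BoseEinsteinCondensation.Theorems.BECTangentRigidityRigidMomentumBoundStubMarginalLimitExtraction
import Summits.AtomisticToContinuum.BoseEinsteinCondensation.Theorems.BECTangentRigidityRigidMomentumBoundStubSliceStability
import Summits.AtomisticToContinuum.BoseEinsteinCondensation.Theorems.BECTangentRigidityRigidMomentumBoundStubSlabNonConcentration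
import Literature.MathematicalPhysics.QuantumManyBody.OneCoordinateMarginal
import Literature.MathematicalPhysics.QuantumManyBody.OneCoordinateMarginalNearWall

/-!
# Line `registered` for the crux `RigidMomentumBound` (route `BECTangentRigidity`) — skeleton v7:
# displacement softness from Hadamard's variational formula and a wall-flux bound

Crux item `stmt-AtomisticToContinuum-13034`; lead `prover-line-stmt-AtomisticToContinuum-13034-c4-0`
(2026-08-17). Published as `Cruxes/RigidMomentumBound/Lines/registered.lean`.

**The crux** (`…Theses.BECTangentRigidity.RigidMomentumBound`): for every repulsive finite-range `v`, at
all small `ρ`, for every `ε > 0`, eventually in `N` there is `δ > 0` such that every `δ`-near-minimiser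
`Ψ` of the Dirichlet energy in the box of side `L_N = (N/ρ)^{1/3}` has `⟨Ψ,P²Ψ⟩ = ∑ₐ∫|∑ⱼ∂_{j,a}Ψ|² ≤ εN²/L_N²`.

**What is landed (leads c2/c3).** König's identity `⟨Ψ,P²Ψ⟩ + N⟨Ψ,H_relΨ⟩ = N⟨Ψ,HΨ⟩`
(`Literature/…/CentreOfMassKineticEnergy.lean`), the rigid-smearing bound
`E₀(N, L+6τ) ≤ E₀^rel(N, L) + 3π²/(4Nτ²)` and the reduction
`Smearing.rigidMomentumBound_of_displacementSoftness`
(`Theorems/BECTangentRigidityRigidMomentumBoundSmearingReduction.lean`): the crux follows from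
**displacement softness** (S4) `E₀(N,L_N) ≤ E₀(N,(1+κ/N)L_N) + εN/L_N²` (all `ε, κ > 0`, eventually in `N`).
Lead c3 showed S4 ⟺ contact softness (exact dilation covariance) and proved the crux's conclusion for
Lipschitz soft-core `v`; hard cores escape every dilation / cut-off route.

**This reshaping (v5): S4 from Hadamard's variational formula.** The cost of pushing the Dirichlet walls of
the box `L'` inward by `w` is controlled by the energy that a near-minimiser carries in the configurations
with a particle within `2w` of a right wall (`stub_shrinkBound`, an elementary product cut-off; PROVABLE).
Summing infinitesimal steps over `L' ∈ [L_N, (1+κ/N)L_N]` is a real-variable chaining lemma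
(`stub_slopeChain`, PROVABLE) which needs right-continuity of `L' ↦ E₀(N,L')` at fixed `N`
(`stub_boxEnergyRightContinuous`: Rellich compactness + lower semicontinuity of the closed form; soft but
not in the tree) and the load-bearing **near-wall energy bound** `stub_nearWallEnergy`: eventually in `N`,
uniformly for `L' ∈ [L_N,(1+κ/N)L_N]`, near-minimisers of the box `L'` carry energy `≤ w·εN²/(κL_N³)` within
`2w` of the right walls for all small `w` — i.e. the WALL FLUX `F(L') = ∑_{j,a}∫_{x_{j,a}=L'}|∂_{j,a}Ψ₀|²`
(`= -dE₀/dL'`, Hadamard) is `≤ (ε/κ)ρN`, against its thermodynamic value `3pL'² ≈ 12πaρN/L'`.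
Strategy for `stub_nearWallEnergy` (lead, `Lines/registered.md`): the local virial identity
`m'' = 2e - 2E₀m` for the one-coordinate marginal `m(t) = ∫|Ψ₀|²_{x_{1,1}=t}` of the ground state, the slice
bound `e ≥ (m')²/(4m) + E₀(N-1,L')m`, hence `(√m)'' ≥ -μ_N √m` with `μ_N = E₀(N,L') - E₀(N-1,L')`; Sturm
comparison gives `√m(L'-s) ≥ √f sin(√μ̄ s)/√μ̄` on a quarter period, so the flux per particle and face
obeys `f ≤ (4/π) μ̄^{3/2} η` with `η` = fraction of particles within `π/(2√μ̄)` of the face; an insertion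
bound (ground-state representation with a nearest-particle Jastrow factor vanishing on `[0,R₀]`) gives
`μ_N ≤ μ̄ = O(ρR₀)` for EVERY admissible `v`, hard cores included; and `η_N → 0` by pair counting whenever
`v` has a repulsive core (`v ≥ c > 0` a.e. near `0`, packing for hard cores). Open: potentials without a
repulsive core (`η_N → 0` is not energetic there), and the ground-state regularity inputs (existence,
weak Euler–Lagrange equation, slice regularity) which the tree does not have.

Disproof used: none exists (`ledger crux ls`, 2026-08-17: no `Disproof.lean`, no `Negative/`, no dead line).
Expired stubs: `stub_pairMomentumDecorrelation` (v1), `stub_displacementSoftness` as a STUB (v3/v4; it is now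
DERIVED below from the four new stubs).
-/

noncomputable section

namespace Summit.AtomisticToContinuum.BoseEinsteinCondensation.Cruxes.RigidMomentumBound.Registered

open MeasureTheory Filter Set
open scoped ENNReal NNReal BigOperators Topology
open Literature.MathematicalPhysics.QuantumManyBody.BoseGas
open Summit.AtomisticToContinuum.BoseEinsteinCondensation.Theses.BECTangentRigidity
open Summit.AtomisticToContinuum.BoseEinsteinCondensation.Theorems.RigidMomentumBound

/-! ## R1 — Hadamard's variational formula: shrinking the box costs the near-wall energy (PROVABLE) -/

/-- **`stub_shrinkBound`** (elementary; size M; LANDED p159423, helpers in `Literature/…/BoseGasWallCutoff.lean` p159063). For a measurable pair potential `v` (hard cores allowed),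
`N` particles, a box of side `L`, a width `0 < w < L/2` and ANY admissible `u` in the box `L`, let
`𝓔 = ∑_{j,a} ∫_{x_{j,a} > L-2w} (|∇u|² + ∑ v |u|²)` be the energy carried by the configurations with the
coordinate `(j,a)` within `2w` of its right wall (counted with multiplicity). Then
`E₀(N, L-w)·(1 - 4w²𝓔) ≤ ⟨u,Hu⟩ + 100·𝓔`.
Proof: multiply `u` by the product cut-off `χ(X) = ∏_{j,a} θ(x_{j,a})`, `θ ∈ C¹`, `θ = 1` on `(-∞, L-2w]`,
`θ = 0` on `[L-w, ∞)`, `|θ'| ≤ c₁/w` (`c₁ = 3/2` for the cubic smoothstep); `χu` is `C¹`, Bose-symmetric and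
vanishes off the box `L-w`, so `E₀(N,L-w)‖χu‖² ≤ ⟨χu,Hχu⟩` (`groundStateEnergy_mul_normSq_le`); pointwise
`|∂_{j,a}(χu)|² ≤ χ²|∂_{j,a}u|² + 1_{x_{j,a} > L-2w}|∂_{j,a}u|² + 2|u|²|∂_{j,a}χ|²` (AM–GM on the cross term) and
`∑v|χu|² ≤ ∑v|u|²`; the one-dimensional Poincaré inequality on `(L-2w, L)` with the zero at `L`
(`∫|f|² ≤ 2w² ∫|f'|²`, along lines, Fubini) bounds the mass with `x_{j,a} > L-2w` by `2w²∫_{x_{j,a}>L-2w}|∂_{j,a}u|²`,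
whence `⟨χu,Hχu⟩ ≤ ⟨u,Hu⟩ + (1 + 4c₁²)𝓔` and `‖χu‖² ≥ 1 - 4w²𝓔`. [Hadamard 1908 (variational half);
folklore] -/
theorem stub_shrinkBound :
    ∀ (v : ℝ → ℝ≥0∞), Measurable v → ∀ {N : ℕ} {L w : ℝ}, 0 < w → 2 * w < L →
      ∀ u : TrialState N L,
        groundStateEnergy v N (L - w) *
            (1 - ENNReal.ofReal (4 * w ^ 2) *
              ∑ j : Fin N, ∑ a : Fin 3, ∫⁻ X in {X : Config N | L - 2 * w < X j a},
                (kineticDensity u.ψ X + interaction v X * (‖u.ψ X‖₊ : ℝ≥0∞) ^ 2)) ≤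
          energy v u +
            100 * ∑ j : Fin N, ∑ a : Fin 3, ∫⁻ X in {X : Config N | L - 2 * w < X j a},
              (kineticDensity u.ψ X + interaction v X * (‖u.ψ X‖₊ : ℝ≥0∞) ^ 2) :=
  -- LANDED p159423
  Summit.AtomisticToContinuum.BoseEinsteinCondensation.Theorems.RigidMomentumBound.stub_shrinkBound

/-! ## R2 — right-continuity of `L ↦ E₀(N, L)` at fixed `N` (soft; Rellich compactness) -/

/-- **`stub_boxEnergyRightContinuous`** (fixed-`N` spectral continuity; LANDED p160846 for EVERY `v`, via Literature `BoseGasEnergyRightContinuity.lean` p160443: Rellich for trial states + Hardy at the face + top-face cut-off). For an admissible `v`, `N`, a box `L > 0` with `E₀(N, L) < ∞` and `η > 0`: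
`E₀(N, L) ≤ E₀(N, L + w) + η` for all small `w > 0` (the infimum over the slightly larger box is not much
lower). Why true: normalised near-ground states `uₙ` of the boxes `L + 1/n` are bounded in `H¹₀`; a
subsequence converges weakly in `H¹` and strongly in `L²` (Rellich) to `u` with `‖u‖ = 1`, vanishing a.e.
off the closed box, hence in `H¹₀` of the open box; each closed form `q̄_{L+1/n}` is `L²`-lower
semicontinuous and they agree on common domains, and a boundary cut-off (Hardy at the faces) puts `u` in the
form domain of the box `L` with `q̄_L(u) ≤ liminf E₀(N, L+1/n)`. (Monotonicity gives the other inequality,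
so `L ↦ E₀(N,L)` is right-continuous wherever it is finite.) [Kato, *Perturbation Theory* VI §1, VIII §3;
Reed–Simon IV Thm XIII.2; folklore] -/
theorem stub_boxEnergyRightContinuous :
    ∀ (v : ℝ → ℝ≥0∞), IsRepulsiveFiniteRange v → ∀ (N : ℕ) (L : ℝ), 0 < L →
      groundStateEnergy v N L ≠ ⊤ → ∀ η : ℝ, 0 < η → ∃ w₀ : ℝ, 0 < w₀ ∧
        ∀ w : ℝ, 0 < w → w < w₀ →
          groundStateEnergy v N L ≤ groundStateEnergy v N (L + w) + ENNReal.ofReal η :=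
  -- LANDED p160846
  Summit.AtomisticToContinuum.BoseEinsteinCondensation.Theorems.RigidMomentumBound.stub_boxEnergyRightContinuous


/-! ## R3 decomposed (v7): five bricks F1 F2 F3 F4 F6 and the glue F7 (lead) -/

/-- **F1 `stub_firstVariation`** (LANDED p160566). First variation of the Rayleigh quotient at a
near-minimiser under a real `C¹` multiplier. For an admissible `Φ` in the box `L` with finite energy
`E = ⟨Φ,HΦ⟩ ≤ E₀(N,L) + δ` (`δ > 0`) and a `C¹` function `G : (ℝ³)^N → ℝ` with `|G| ≤ 1` and
`∑_{i,k}|∂_{i,k}G|² ≤ D²`, the functions `(1 + εG)Φ` are `C¹` and vanish off the box, so the DIRICHLET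
BOSONIC FLOOR (`DirichletFloor.groundStateEnergy_mul_lintegral_le`, no symmetry needed) gives
`⟨(1+εG)Φ, H(1+εG)Φ⟩ ≥ E₀‖(1+εG)Φ‖² ≥ (E - δ)‖(1+εG)Φ‖²` for every real `ε`; both sides are quadratic
polynomials in `ε` (`|∇((1+εG)Φ)|² = (1+εG)²|∇Φ|² + 2ε(1+εG)∇G·Re(Φ̄∇Φ) + ε²|Φ|²|∇G|²`), and comparing at
`ε = ±√δ` yields `|∫G e_Φ + ∫∇G·Re(Φ̄∇Φ) - E∫G|Φ|²| ≤ √δ(3E + 2D² + δ + 1) + δ`, where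
`e_Φ = |∇Φ|² + ∑v|Φ|²` is the energy density (`∫|Φ|² = 1`, Cauchy–Schwarz `∫|∇G||Φ||∇Φ| ≤ D√E`). This is
the engine of the local virial identity (`G = g(x_{j,a})`) and of the insertion bound (`G = ∫φ²J²`).
[folklore: first variation / virial] -/
theorem stub_firstVariation :
    ∀ (v : ℝ → ℝ≥0∞), Measurable v → ∀ {N : ℕ} {L : ℝ} (Φ : TrialState N L) (G : Config N → ℝ) (D : ℝ),
      ContDiff ℝ 1 G → (∀ X, |G X| ≤ 1) →
      (∀ X, ∑ i : Fin N, ∑ k : Fin 3,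
          (fderiv ℝ G X (Pi.single i (EuclideanSpace.single k (1 : ℝ)))) ^ 2 ≤ D ^ 2) →
      0 ≤ D → energy v Φ ≠ ⊤ → ∀ δ : ℝ, 0 < δ →
      energy v Φ ≤ groundStateEnergy v N L + ENNReal.ofReal δ →
      |(∫ X, G X * (kineticDensity Φ.ψ X + interaction v X * (‖Φ.ψ X‖₊ : ℝ≥0∞) ^ 2).toReal) +
          (∫ X, ∑ i : Fin N, ∑ k : Fin 3,
            fderiv ℝ G X (Pi.single i (EuclideanSpace.single k (1 : ℝ))) *
              RCLike.re (starRingEnd ℂ (Φ.ψ X) *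
                fderiv ℝ Φ.ψ X (Pi.single i (EuclideanSpace.single k (1 : ℝ))))) -
          (energy v Φ).toReal * ∫ X, G X * ‖Φ.ψ X‖ ^ 2|
        ≤ Real.sqrt δ * (3 * (energy v Φ).toReal + 2 * D ^ 2 + δ + 1) + δ :=
  -- LANDED p160566
  Summit.AtomisticToContinuum.BoseEinsteinCondensation.Theorems.RigidMomentumBound.stub_firstVariation

/-- **F2 `stub_weightedGroupFloor`** (LANDED p160257). Weighted group extraction with the group
"all particles but particle `0`", which is UNCONSTRAINED (so no artificial boundary appears): for an
admissible `Φ` of `N+1` particles in the box `L` and any measurable weight `wt ≥ 0` of the position of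
particle `0`, the kinetic energy of particles `1..N` plus their mutual interaction, weighted by `wt(x₀)`,
is at least `E₀(N,L)` times the weighted mass. Proof: `groundStateEnergy_mul_le_setLIntegral_group`
(`BoseGasDirichletMonotonicity.lean`) with `ι = Fin.succ`, `u = 0`, `ℓ = L` and `A = wt⁻¹(level sets)`,
then simple-function approximation / layer cake in `wt`. [cite: LSSY2005, (2.52)–(2.53); folklore] -/
theorem stub_weightedGroupFloor :
    ∀ (v : ℝ → ℝ≥0∞), Measurable v → ∀ {N : ℕ} {L : ℝ} (Φ : TrialState (N + 1) L)
      (wt : Space → ℝ≥0∞), Measurable wt →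
      groundStateEnergy v N L * ∫⁻ X, wt (X 0) * (‖Φ.ψ X‖₊ : ℝ≥0∞) ^ 2 ≤
        ∫⁻ X, wt (X 0) *
          (∑ i : Fin N, ∑ k : Fin 3,
              (‖fderiv ℝ Φ.ψ X (Pi.single i.succ (EuclideanSpace.single k (1 : ℝ)))‖₊ : ℝ≥0∞) ^ 2 +
            interaction v (fun i : Fin N => X i.succ) * (‖Φ.ψ X‖₊ : ℝ≥0∞) ^ 2) :=
  -- LANDED p160257
  Summit.AtomisticToContinuum.BoseEinsteinCondensation.Theorems.RigidMomentumBound.stub_weightedGroupFloor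

/-- **F3 `stub_insertionBound`** (PROVABLE; size L; stated as an implication from the first-variation brick F1, which its proof uses). Chemical-potential bound for EVERY measurable
finite-range `v ≥ 0` (hard cores included): for `N` particles in the box `L` at density
`N R₀³ ≤ L³/2000` (`R₀` the range), `E₀(N+1,L) ≤ E₀(N,L) + 120/L² + 13000·N·R₀/L³`. Proof: take a
`δ`-near-minimiser `Φ` of the `N`-body problem and the trial function `Ψ(X,x) = Φ(X)φ(x)J(x;X)` with
`φ = ∏ₐ√(2/L)sin(πxₐ/L)` and the SMOOTH soft-min Jastrow factor
`J(x;X) = f(-ϱ log ∑ⱼ exp(-|x-xⱼ|/ϱ))`, `ϱ = R₀/log(N+2)`, `f ∈ C¹`, `f = 0` on `[0,R₀]`, `f = 1` on `[2R₀,∞)`,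
`0 ≤ f' ≤ 3/(2R₀)`: the soft-min is `≤ minⱼ|x-xⱼ|` (so `v(x-xⱼ)J² = 0`: the added particle does not
interact at all, `⊤·0 = 0`) and `≥ minⱼ|x-xⱼ| - R₀` (so `J = 1` unless some `xⱼ` is within `3R₀` of `x`),
and its gradients are softmax-convex combinations of unit vectors: `|∇ₓJ| ≤ ‖f'‖_∞`,
`∑ⱼ|∇_{xⱼ}J|² ≤ ‖f'‖²_∞`. Then `⟨Ψ,H_{N+1}Ψ⟩ = ∫g e_Φ + ∫∇g·Re(Φ̄∇Φ)/… + ∫|Φ|²k` with `g(X) = ∫φ²J²dx ∈ [0,1]`,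
`k(X) = ∫(|∇ₓ(φJ)|² + φ²∑ⱼ|∇_{xⱼ}J|²)dx ≤ 6π²/L² + 3‖f'‖²_∞(8/L³)·N·36πR₀³`; `stub_firstVariation` turns the
first two terms into `E(Φ)‖Ψ‖² + O(√δ)`, the Dirichlet bosonic floor gives `E₀(N+1)‖Ψ‖² ≤ ⟨Ψ,HΨ⟩`,
`‖Ψ‖² ≥ 1 - (8/L³)N·36πR₀³·… ≥ 1/2`, and `δ → 0`. [folklore: insertion of a particle with a Jastrow factor] -/
theorem stub_insertionBound :
    (      ∀ (v : ℝ → ℝ≥0∞), Measurable v → ∀ {N : ℕ} {L : ℝ} (Φ : TrialState N L) (G : Config N → ℝ) (D : ℝ),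
      ContDiff ℝ 1 G → (∀ X, |G X| ≤ 1) →
      (∀ X, ∑ i : Fin N, ∑ k : Fin 3,
      (fderiv ℝ G X (Pi.single i (EuclideanSpace.single k (1 : ℝ)))) ^ 2 ≤ D ^ 2) →
      0 ≤ D → energy v Φ ≠ ⊤ → ∀ δ : ℝ, 0 < δ →
      energy v Φ ≤ groundStateEnergy v N L + ENNReal.ofReal δ →
      |(∫ X, G X * (kineticDensity Φ.ψ X + interaction v X * (‖Φ.ψ X‖₊ : ℝ≥0∞) ^ 2).toReal) +
      (∫ X, ∑ i : Fin N, ∑ k : Fin 3,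
      fderiv ℝ G X (Pi.single i (EuclideanSpace.single k (1 : ℝ))) *
      RCLike.re (starRingEnd ℂ (Φ.ψ X) *
      fderiv ℝ Φ.ψ X (Pi.single i (EuclideanSpace.single k (1 : ℝ))))) -
      (energy v Φ).toReal * ∫ X, G X * ‖Φ.ψ X‖ ^ 2|
      ≤ Real.sqrt δ * (3 * (energy v Φ).toReal + 2 * D ^ 2 + δ + 1) + δ) →
    ∀ (v : ℝ → ℝ≥0∞), Measurable v → ∀ R₀ : ℝ, 0 < R₀ → (∀ r, R₀ < r → v r = 0) →
      ∀ (N : ℕ) (L : ℝ), 0 < L → 8 * R₀ ≤ L → (N : ℝ) * R₀ ^ 3 ≤ L ^ 3 / 2000 →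
        groundStateEnergy v (N + 1) L ≤
          groundStateEnergy v N L + ENNReal.ofReal (120 / L ^ 2 + 13000 * N * R₀ / L ^ 3) :=
  Summit.AtomisticToContinuum.BoseEinsteinCondensation.Theorems.RigidMomentumBound.stub_insertionBound

/-- **F4 `stub_slabNonConcentration`** (PROVABLE but heavy; size L). Wall depletion at a fixed distance:
for every repulsive finite-range `v`, at small density `ρ`, there is `s₁ = s₁(v,ρ) > 0` such that for every
slab width `0 < s ≤ s₁`, every `θ > 0` and every window parameter `κ > 0`, eventually in `N`, uniformly for
boxes `L' ∈ [L_N,(1+κ/N)L_N]`, every `1`-near-minimiser `Φ` has at most `θN` particles (in expectation)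
within `s` of any right wall. Why true / route: if a fraction `η` sits in the slab (volume fraction
`s/L' → 0`), its density diverges; Neumann bracketing of the Dirichlet state into cells of side `ℓ`
(state-wise cell method of `BoseGasSubcellNoClumping.lean`, `mul_sum_mass_mul_excess_le`), the Neumann
thermodynamic limit with boundary-condition independence (uniform on density compacts by monotonicity +
continuity of the limit), STRICT convexity of the energy density between `ρ/2` and `2ρ` (LSSY lower bound
and Dyson upper bound, both proved in the tree, give slope gap `≥ 6πaρ(1-o(1))` for `a > 0`), and the
`o(N)` precision of `E₀^D(N,L_N)` from the Dirichlet thermodynamic limit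
(`tendsto_energyPerParticleDirichlet_of_lt_criticalDensity`) force `η ≤ ε_ℓ/(6πaρ²…) + o(1) → 0`. For
`v = 0` a.e. (`a = 0`) use the explicit sine-product ground state / the free bound instead. For cored `v`
(`v ≥ c > 0` a.e. near `0`, hard cores included) pair counting gives the rate `η ≲ N^{-1/6}` directly
(`Theorems/BECTangentRigidityRigidMomentumBoundStubPairCounting.lean`). [cite: LSSY2005 (2.52)–(2.58);
Ruelle1969 §3.5; folklore] -/
theorem stub_slabNonConcentration :
    ∀ v : ℝ → ℝ≥0∞, IsRepulsiveFiniteRange v → ∃ ρ₀ : ℝ, 0 < ρ₀ ∧ ∀ ρ : ℝ, 0 < ρ → ρ < ρ₀ →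
      ∃ s₁ : ℝ, 0 < s₁ ∧ ∀ s : ℝ, 0 < s → s ≤ s₁ → ∀ θ : ℝ, 0 < θ → ∀ κ : ℝ, 0 < κ →
        ∀ᶠ N : ℕ in atTop, ∀ L' ∈ Set.Icc (sideLength ρ N) ((1 + κ / N) * sideLength ρ N),
          ∀ Φ : TrialState N L', energy v Φ ≤ groundStateEnergy v N L' + 1 →
            ∀ a : Fin 3, (∑ j : Fin N, ∫⁻ X in {X : Config N | L' - s < X j a},
                (‖Φ.ψ X‖₊ : ℝ≥0∞) ^ 2) ≤ ENNReal.ofReal (θ * N) :=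
  Summit.AtomisticToContinuum.BoseEinsteinCondensation.Theorems.RigidMomentumBound.stub_slabNonConcentration

/-- **F6 `stub_sturmPackage`** (PROVABLE; pure one-dimensional real analysis; size L). The Sturm /
Picone comparison package for the one-coordinate marginal of a ground state, in weak form. Coordinates:
the wall is at `s = 0`, the box extends to `S`. Data: the marginal mass `m ≥ 0` (continuous, `m(0) = 0`,
`m = ∫₀ p`), the normal slice kinetic energy `et ≥ 0` and the full slice energy `e ≥ et` (integrable), with
the Cauchy–Schwarz relation `p² ≤ 4 m·et` a.e., the local virial identity
`∫g e + ½∫g'p = E'∫g m` for every `C¹` test function `g`, the slice bound `∫g e ≥ ∫g et + E₁∫g m` for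
`g ≥ 0`, a chemical-potential bound `E' - E₁ ≤ μ`, and slab mass `∫₀^{2s₀} m ≤ η` at the quarter period
`s₀ = π/(2√μ)` (`2s₀ ≤ S`). Conclusion: `∫₀^σ et ≤ 8 μ^{3/2} η σ` for every `0 < σ ≤ s₀/2`. Route:
`q = √m` is absolutely continuous with `q'² = p²/(4m) ≤ et`; the hypotheses give `∫g q'² + ∫g' q q' ≤ μ∫g q²`
(`g ≥ 0`), i.e. `T := (qq')' + μq² - q'² ≥ 0` as a measure, so `qq' ∈ BV`; Wronskian/Picone comparison with
`sin(√μ s)` from the wall gives `q' ≥ 0` on `[0,s₀]`, and the matched comparison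
`q(s) ≥ q(σ)cos(√μ(s-σ)) + (q'(σ⁺)/√μ)sin(√μ(s-σ))` from any `σ ≤ s₀` bounds `q'(σ⁺)² ≤ 2μη/s₀ = (4/π)μ^{3/2}η =: Φ`;
hence `m(σ) ≤ Φσ²` and, testing the virial identity against the (smoothed) indicator of `[0,σ]`,
`∫₀^σ et ≤ ½p(σ⁺) + μ∫₀^σ m ≤ Φσ(1 + π²/48)`. [Sturm 1836; Picone 1910; folklore] -/
theorem stub_sturmPackage :
    ∀ (S μ η E' E₁ : ℝ) (m p et e : ℝ → ℝ), 0 < μ → 0 ≤ η → E' - E₁ ≤ μ →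
      2 * (Real.pi / (2 * Real.sqrt μ)) ≤ S →
      ContinuousOn m (Set.Icc 0 S) → m 0 = 0 → (∀ s ∈ Set.Icc 0 S, 0 ≤ m s) →
      IntegrableOn p (Set.Icc 0 S) → IntegrableOn et (Set.Icc 0 S) → IntegrableOn e (Set.Icc 0 S) →
      (∀ s ∈ Set.Icc 0 S, m s = ∫ x in (0 : ℝ)..s, p x) →
      (∀ᵐ s ∂(volume.restrict (Set.Icc 0 S)), 0 ≤ et s ∧ et s ≤ e s ∧ p s ^ 2 ≤ 4 * m s * et s) →
      (∀ g : ℝ → ℝ, ContDiff ℝ 1 g →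
        (∫ s in (0 : ℝ)..S, g s * e s) + (1 / 2) * (∫ s in (0 : ℝ)..S, deriv g s * p s) =
          E' * ∫ s in (0 : ℝ)..S, g s * m s) →
      (∀ g : ℝ → ℝ, ContDiff ℝ 1 g → (∀ s, 0 ≤ g s) →
        (∫ s in (0 : ℝ)..S, g s * et s) + E₁ * (∫ s in (0 : ℝ)..S, g s * m s) ≤
          ∫ s in (0 : ℝ)..S, g s * e s) →
      (∫ s in (0 : ℝ)..(2 * (Real.pi / (2 * Real.sqrt μ))), m s) ≤ η →
      ∀ σ : ℝ, 0 < σ → σ ≤ Real.pi / (2 * Real.sqrt μ) / 2 →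
        (∫ s in (0 : ℝ)..σ, et s) ≤ 8 * μ * Real.sqrt μ * η * σ :=
  Summit.AtomisticToContinuum.BoseEinsteinCondensation.Theorems.RigidMomentumBound.stub_sturmPackage

/-! ## G — the glue's own inputs (v8): pure 1-D post-processing and the marginal limit package -/

/-- **G5 `stub_fullSliceEnergy1D` (pure 1-D; size S/M).** From the virial identity, Cauchy–Schwarz
`p² ≤ 4 m e_t` and a LINEAR bound `∫₀^σ e_t ≤ Aσ` near the wall, the FULL slice energy obeys
`∫₀^σ e ≤ 12Aσ + 32E'Aσ³` (`2σ ≤ s₁`): maximum principle `max_{[0,s]} m ≤ 4s∫₀ˢe_t`, then test the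
virial identity with a `C¹` ramp (`1` on `[0,σ]`, `0` after `2σ`, slope `≤ 2/σ`). [folklore] -/
theorem stub_fullSliceEnergy1D :
    ∀ (S E' A s₁ : ℝ) (m p et e : ℝ → ℝ), 0 ≤ E' → 0 ≤ A → 0 < s₁ → s₁ ≤ S →
      ContinuousOn m (Set.Icc 0 S) → m 0 = 0 → (∀ s ∈ Set.Icc 0 S, 0 ≤ m s) →
      MeasureTheory.IntegrableOn p (Set.Icc 0 S) → MeasureTheory.IntegrableOn et (Set.Icc 0 S) →
      MeasureTheory.IntegrableOn e (Set.Icc 0 S) →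
      (∀ s ∈ Set.Icc 0 S, m s = ∫ x in (0 : ℝ)..s, p x) →
      (∀ᵐ s ∂(MeasureTheory.volume.restrict (Set.Icc 0 S)), 0 ≤ et s ∧ et s ≤ e s ∧ p s ^ 2 ≤ 4 * m s * et s) →
      (∀ g : ℝ → ℝ, ContDiff ℝ 1 g →
        (∫ s in (0 : ℝ)..S, g s * e s) + (1 / 2) * (∫ s in (0 : ℝ)..S, deriv g s * p s) =
          E' * ∫ s in (0 : ℝ)..S, g s * m s) →
      (∀ σ : ℝ, 0 < σ → σ ≤ s₁ → (∫ s in (0 : ℝ)..σ, et s) ≤ A * σ) →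
      ∀ σ : ℝ, 0 < σ → 2 * σ ≤ s₁ → (∫ s in (0 : ℝ)..σ, e s) ≤ 12 * A * σ + 32 * E' * A * σ ^ 3 :=
  Summit.AtomisticToContinuum.BoseEinsteinCondensation.Theorems.RigidMomentumBound.stub_fullSliceEnergy1D

/-- **G4a `stub_energyCauchy`** (energy-Cauchy property of near-minimisers; size M). -/
theorem stub_energyCauchy :
    ∀ (v : ℝ → ℝ≥0∞), Measurable v → ∀ {N : ℕ} {L : ℝ} (Φ Ψ : TrialState N L) (δ : ℝ), 0 ≤ δ →
      groundStateEnergy v N L ≠ ⊤ →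
      energy v Φ ≤ groundStateEnergy v N L + ENNReal.ofReal δ →
      energy v Ψ ≤ groundStateEnergy v N L + ENNReal.ofReal δ →
      ∫⁻ X, (kineticDensity (fun X => Φ.ψ X - Ψ.ψ X) X +
          interaction v X * (‖Φ.ψ X - Ψ.ψ X‖₊ : ℝ≥0∞) ^ 2) ≤
        groundStateEnergy v N L * (∫⁻ X, (‖Φ.ψ X - Ψ.ψ X‖₊ : ℝ≥0∞) ^ 2) +
          ENNReal.ofReal (4 * δ) :=
  Summit.AtomisticToContinuum.BoseEinsteinCondensation.Theorems.RigidMomentumBound.stub_energyCauchy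

/-- **G4b `stub_sliceStability`** (slice data are Lipschitz in the energy norm; size M). -/
theorem stub_sliceStability :
    ∀ (v : ℝ → ℝ≥0∞), Measurable v → ∀ {N : ℕ} {L : ℝ}, 0 < L → ∀ (Φ Ψ : TrialState N L)
      (p : Fin N × Fin 3), energy v Φ ≠ ⊤ → energy v Ψ ≠ ⊤ →
      (∫⁻ X, (kineticDensity (fun X => Φ.ψ X - Ψ.ψ X) X +
          interaction v X * (‖Φ.ψ X - Ψ.ψ X‖₊ : ℝ≥0∞) ^ 2)) ≠ ⊤ →
      (∫ t in (0 : ℝ)..L, |sliceEnergyReal v Φ.ψ p t - sliceEnergyReal v Ψ.ψ p t|) ≤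
          Real.sqrt (∫⁻ X, (kineticDensity (fun X => Φ.ψ X - Ψ.ψ X) X +
              interaction v X * (‖Φ.ψ X - Ψ.ψ X‖₊ : ℝ≥0∞) ^ 2)).toReal *
            Real.sqrt (2 * ((energy v Φ).toReal + (energy v Ψ).toReal)) ∧
      (∫ t in (0 : ℝ)..L, |normalSliceEnergyReal Φ.ψ p t - normalSliceEnergyReal Ψ.ψ p t|) ≤
          Real.sqrt (∫⁻ X, (kineticDensity (fun X => Φ.ψ X - Ψ.ψ X) X +
              interaction v X * (‖Φ.ψ X - Ψ.ψ X‖₊ : ℝ≥0∞) ^ 2)).toReal *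
            Real.sqrt (2 * ((energy v Φ).toReal + (energy v Ψ).toReal)) ∧
      (∫ t in (0 : ℝ)..L, |sliceCurrent Φ.ψ p t - sliceCurrent Ψ.ψ p t|) ≤
          Real.sqrt (∫⁻ X, (‖Φ.ψ X - Ψ.ψ X‖₊ : ℝ≥0∞) ^ 2).toReal * Real.sqrt (energy v Φ).toReal +
            Real.sqrt (∫⁻ X, (kineticDensity (fun X => Φ.ψ X - Ψ.ψ X) X +
              interaction v X * (‖Φ.ψ X - Ψ.ψ X‖₊ : ℝ≥0∞) ^ 2)).toReal :=
  Summit.AtomisticToContinuum.BoseEinsteinCondensation.Theorems.RigidMomentumBound.stub_sliceStability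

/-- **G4c `stub_slicePackageFinite`** (the one-coordinate slice data of ONE finite-energy trial
state, in wall coordinates `s = L - x_{0,a}`; size L). -/
theorem stub_slicePackageFinite :
    ∀ (v : ℝ → ℝ≥0∞), Measurable v → ∀ (n : ℕ) (L : ℝ), 0 < L → ∀ (Φ : TrialState (n + 1) L),
      energy v Φ ≠ ⊤ → ∀ a : Fin 3,
      (Continuous fun s : ℝ => marginalMassReal Φ.ψ ((0 : Fin (n + 1)), a) (L - s)) ∧
      marginalMassReal Φ.ψ ((0 : Fin (n + 1)), a) L = 0 ∧
      (∀ s : ℝ, 0 ≤ marginalMassReal Φ.ψ ((0 : Fin (n + 1)), a) (L - s)) ∧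
      Integrable (fun s : ℝ => sliceCurrent Φ.ψ ((0 : Fin (n + 1)), a) (L - s)) ∧
      Integrable (fun s : ℝ => normalSliceEnergyReal Φ.ψ ((0 : Fin (n + 1)), a) (L - s)) ∧
      Integrable (fun s : ℝ => sliceEnergyReal v Φ.ψ ((0 : Fin (n + 1)), a) (L - s)) ∧
      (∀ s : ℝ, marginalMassReal Φ.ψ ((0 : Fin (n + 1)), a) (L - s) =
        ∫ x in (0 : ℝ)..s, -2 * sliceCurrent Φ.ψ ((0 : Fin (n + 1)), a) (L - x)) ∧
      (∀ s : ℝ, 0 ≤ normalSliceEnergyReal Φ.ψ ((0 : Fin (n + 1)), a) (L - s) ∧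
        (-2 * sliceCurrent Φ.ψ ((0 : Fin (n + 1)), a) (L - s)) ^ 2 ≤
          4 * marginalMassReal Φ.ψ ((0 : Fin (n + 1)), a) (L - s) *
            normalSliceEnergyReal Φ.ψ ((0 : Fin (n + 1)), a) (L - s)) ∧
      (∀ᵐ s : ℝ, normalSliceEnergyReal Φ.ψ ((0 : Fin (n + 1)), a) (L - s) ≤
        sliceEnergyReal v Φ.ψ ((0 : Fin (n + 1)), a) (L - s)) ∧
      (∀ g : ℝ → ℝ, ContDiff ℝ 1 g → (∀ s, |g s| ≤ 1) → ∀ D : ℝ, 0 ≤ D → (∀ s, |deriv g s| ≤ D) →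
        ∀ δ : ℝ, 0 < δ → energy v Φ ≤ groundStateEnergy v (n + 1) L + ENNReal.ofReal δ →
        |(∫ s in (0 : ℝ)..L, g s * sliceEnergyReal v Φ.ψ ((0 : Fin (n + 1)), a) (L - s)) +
            (1 / 2) * (∫ s in (0 : ℝ)..L,
              deriv g s * (-2 * sliceCurrent Φ.ψ ((0 : Fin (n + 1)), a) (L - s))) -
            (energy v Φ).toReal *
              ∫ s in (0 : ℝ)..L, g s * marginalMassReal Φ.ψ ((0 : Fin (n + 1)), a) (L - s)| ≤
          Real.sqrt δ * (3 * (energy v Φ).toReal + 2 * D ^ 2 + δ + 1) + δ) ∧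
      (∀ g : ℝ → ℝ, ContDiff ℝ 1 g → (∀ s, 0 ≤ g s) → (∀ s, g s ≤ 1) →
        (∫ s in (0 : ℝ)..L, g s * normalSliceEnergyReal Φ.ψ ((0 : Fin (n + 1)), a) (L - s)) +
            (groundStateEnergy v n L).toReal *
              (∫ s in (0 : ℝ)..L, g s * marginalMassReal Φ.ψ ((0 : Fin (n + 1)), a) (L - s)) ≤
          ∫ s in (0 : ℝ)..L, g s * sliceEnergyReal v Φ.ψ ((0 : Fin (n + 1)), a) (L - s)) :=
  Summit.AtomisticToContinuum.BoseEinsteinCondensation.Theorems.RigidMomentumBound.stub_slicePackageFinite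

/-- **G4x `stub_marginalLimitExtraction` (lead; v8.3 signature `(G4b) → (G4)` — the gate caps registered
signatures at 3900 characters, so the landed inputs G4a `stub_energyCauchy` (p163555) and G4c
`stub_slicePackageFinite` (p164286) are used inside the proof instead of being hypotheses).** The limit
extraction: Rellich subsequence of a minimising sequence, energy-Cauchy (G4a) ⇒ `L²`/energy-norm Cauchy,
slice stability (G4b) ⇒ `L¹(0,L)` Cauchy moduli of the slice data, limits by completeness of `L¹`
(`Literature…exists_sliceLimit_of_sequence`). [folklore: direct method] -/
theorem stub_marginalLimitExtraction :
    (
      ∀ (v : ℝ → ℝ≥0∞), Measurable v → ∀ {N : ℕ} {L : ℝ}, 0 < L → ∀ (Φ Ψ : TrialState N L)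
        (p : Fin N × Fin 3), energy v Φ ≠ ⊤ → energy v Ψ ≠ ⊤ →
        (∫⁻ X, (kineticDensity (fun X => Φ.ψ X - Ψ.ψ X) X +
            interaction v X * (‖Φ.ψ X - Ψ.ψ X‖₊ : ℝ≥0∞) ^ 2)) ≠ ⊤ →
        (∫ t in (0 : ℝ)..L, |sliceEnergyReal v Φ.ψ p t - sliceEnergyReal v Ψ.ψ p t|) ≤
            Real.sqrt (∫⁻ X, (kineticDensity (fun X => Φ.ψ X - Ψ.ψ X) X +
                interaction v X * (‖Φ.ψ X - Ψ.ψ X‖₊ : ℝ≥0∞) ^ 2)).toReal *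
              Real.sqrt (2 * ((energy v Φ).toReal + (energy v Ψ).toReal)) ∧
        (∫ t in (0 : ℝ)..L, |normalSliceEnergyReal Φ.ψ p t - normalSliceEnergyReal Ψ.ψ p t|) ≤
            Real.sqrt (∫⁻ X, (kineticDensity (fun X => Φ.ψ X - Ψ.ψ X) X +
                interaction v X * (‖Φ.ψ X - Ψ.ψ X‖₊ : ℝ≥0∞) ^ 2)).toReal *
              Real.sqrt (2 * ((energy v Φ).toReal + (energy v Ψ).toReal)) ∧
        (∫ t in (0 : ℝ)..L, |sliceCurrent Φ.ψ p t - sliceCurrent Ψ.ψ p t|) ≤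
            Real.sqrt (∫⁻ X, (‖Φ.ψ X - Ψ.ψ X‖₊ : ℝ≥0∞) ^ 2).toReal * Real.sqrt (energy v Φ).toReal +
              Real.sqrt (∫⁻ X, (kineticDensity (fun X => Φ.ψ X - Ψ.ψ X) X +
                interaction v X * (‖Φ.ψ X - Ψ.ψ X‖₊ : ℝ≥0∞) ^ 2)).toReal) →
    (
      ∀ (v : ℝ → ℝ≥0∞), Measurable v → ∀ (n : ℕ) (L : ℝ), 0 < L →
        groundStateEnergy v (n + 1) L ≠ ⊤ → groundStateEnergy v n L ≠ ⊤ →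
        ∃ (m p et e : Fin 3 → ℝ → ℝ),
          (∀ a : Fin 3,
            ContinuousOn (m a) (Set.Icc 0 L) ∧ m a 0 = 0 ∧ (∀ s ∈ Set.Icc 0 L, 0 ≤ m a s) ∧
            IntegrableOn (p a) (Set.Icc 0 L) ∧ IntegrableOn (et a) (Set.Icc 0 L) ∧
            IntegrableOn (e a) (Set.Icc 0 L) ∧
            (∀ s ∈ Set.Icc 0 L, m a s = ∫ x in (0 : ℝ)..s, p a x) ∧
            (∀ᵐ s ∂(volume.restrict (Set.Icc 0 L)),
              0 ≤ et a s ∧ et a s ≤ e a s ∧ p a s ^ 2 ≤ 4 * m a s * et a s) ∧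
            (∀ g : ℝ → ℝ, ContDiff ℝ 1 g →
              (∫ s in (0 : ℝ)..L, g s * e a s) + (1 / 2) * (∫ s in (0 : ℝ)..L, deriv g s * p a s) =
                (groundStateEnergy v (n + 1) L).toReal * ∫ s in (0 : ℝ)..L, g s * m a s) ∧
            (∀ g : ℝ → ℝ, ContDiff ℝ 1 g → (∀ s, 0 ≤ g s) →
              (∫ s in (0 : ℝ)..L, g s * et a s) +
                  (groundStateEnergy v n L).toReal * (∫ s in (0 : ℝ)..L, g s * m a s) ≤
                ∫ s in (0 : ℝ)..L, g s * e a s) ∧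
            (∀ b ∈ Set.Icc 0 L, ∀ K : ℝ,
              (∀ Φ : TrialState (n + 1) L, energy v Φ ≤ groundStateEnergy v (n + 1) L + 1 →
                (∫ s in (0 : ℝ)..b, marginalMassReal Φ.ψ ((0 : Fin (n + 1)), a) (L - s)) ≤ K) →
              (∫ s in (0 : ℝ)..b, m a s) ≤ K)) ∧
          (∀ σ ∈ Set.Icc 0 L, ∀ θ : ℝ, 0 < θ → ∃ Φ : TrialState (n + 1) L,
            energy v Φ ≤ groundStateEnergy v (n + 1) L + ENNReal.ofReal θ ∧
            ∀ a : Fin 3, (∫ s in (0 : ℝ)..σ, sliceEnergyReal v Φ.ψ ((0 : Fin (n + 1)), a) (L - s)) ≤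
              (∫ s in (0 : ℝ)..σ, e a s) + θ)) :=
  Summit.AtomisticToContinuum.BoseEinsteinCondensation.Theorems.RigidMomentumBound.stub_marginalLimitExtraction

/-- **G4 `stub_marginalLimit` (the marginal limit package; DERIVED from G4a–G4c by the extraction G4x).** Along a
minimising sequence `Φₖ` of the Dirichlet problem (`n+1` particles, box `L`), after a Rellich
subsequence (`BoxFace.exists_subseq_tendsto_of_trialStates`) the states are Cauchy in `L²`, hence by
`stub_energyCauchy` Cauchy in the energy norm, hence by `stub_sliceStability` the one-coordinate slice
data of particle `0` (wall coordinates, all three directions; finite-`k` properties from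
`stub_slicePackageFinite`) are Cauchy in `L¹(0,L)` (masses uniformly); the `L¹` limits satisfy the
exact local virial identity (`E' = E₀(n+1,L)`), the slice bound (`E₁ = E₀(n,L)`), Cauchy–Schwarz a.e.,
and transfer of mass bounds / slice energies back to near-minimisers. [folklore: direct method] -/
theorem stub_marginalLimit :
    ∀ (v : ℝ → ℝ≥0∞), Measurable v → ∀ (n : ℕ) (L : ℝ), 0 < L →
      groundStateEnergy v (n + 1) L ≠ ⊤ → groundStateEnergy v n L ≠ ⊤ →
      ∃ (m p et e : Fin 3 → ℝ → ℝ),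
        (∀ a : Fin 3,
          ContinuousOn (m a) (Set.Icc 0 L) ∧ m a 0 = 0 ∧ (∀ s ∈ Set.Icc 0 L, 0 ≤ m a s) ∧
          IntegrableOn (p a) (Set.Icc 0 L) ∧ IntegrableOn (et a) (Set.Icc 0 L) ∧
          IntegrableOn (e a) (Set.Icc 0 L) ∧
          (∀ s ∈ Set.Icc 0 L, m a s = ∫ x in (0 : ℝ)..s, p a x) ∧
          (∀ᵐ s ∂(volume.restrict (Set.Icc 0 L)),
            0 ≤ et a s ∧ et a s ≤ e a s ∧ p a s ^ 2 ≤ 4 * m a s * et a s) ∧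
          (∀ g : ℝ → ℝ, ContDiff ℝ 1 g →
            (∫ s in (0 : ℝ)..L, g s * e a s) + (1 / 2) * (∫ s in (0 : ℝ)..L, deriv g s * p a s) =
              (groundStateEnergy v (n + 1) L).toReal * ∫ s in (0 : ℝ)..L, g s * m a s) ∧
          (∀ g : ℝ → ℝ, ContDiff ℝ 1 g → (∀ s, 0 ≤ g s) →
            (∫ s in (0 : ℝ)..L, g s * et a s) +
                (groundStateEnergy v n L).toReal * (∫ s in (0 : ℝ)..L, g s * m a s) ≤
              ∫ s in (0 : ℝ)..L, g s * e a s) ∧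
          (∀ b ∈ Set.Icc 0 L, ∀ K : ℝ,
            (∀ Φ : TrialState (n + 1) L, energy v Φ ≤ groundStateEnergy v (n + 1) L + 1 →
              (∫ s in (0 : ℝ)..b, marginalMassReal Φ.ψ ((0 : Fin (n + 1)), a) (L - s)) ≤ K) →
            (∫ s in (0 : ℝ)..b, m a s) ≤ K)) ∧
        (∀ σ ∈ Set.Icc 0 L, ∀ θ : ℝ, 0 < θ → ∃ Φ : TrialState (n + 1) L,
          energy v Φ ≤ groundStateEnergy v (n + 1) L + ENNReal.ofReal θ ∧
          ∀ a : Fin 3, (∫ s in (0 : ℝ)..σ, sliceEnergyReal v Φ.ψ ((0 : Fin (n + 1)), a) (L - s)) ≤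
            (∫ s in (0 : ℝ)..σ, e a s) + θ) :=
  stub_marginalLimitExtraction stub_sliceStability


section Glue

/-! ## F7 — the glue (lead): R3 from F3, F4, F6, G4, G5 (sorry-free) -/

variable
  (hF3 :
    ∀ (v : ℝ → ℝ≥0∞), Measurable v → ∀ R₀ : ℝ, 0 < R₀ → (∀ r, R₀ < r → v r = 0) →
      ∀ (N : ℕ) (L : ℝ), 0 < L → 8 * R₀ ≤ L → (N : ℝ) * R₀ ^ 3 ≤ L ^ 3 / 2000 →
        groundStateEnergy v (N + 1) L ≤
          groundStateEnergy v N L + ENNReal.ofReal (120 / L ^ 2 + 13000 * N * R₀ / L ^ 3))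
  (hF4 :
    ∀ v : ℝ → ℝ≥0∞, IsRepulsiveFiniteRange v → ∃ ρ₀ : ℝ, 0 < ρ₀ ∧ ∀ ρ : ℝ, 0 < ρ → ρ < ρ₀ →
      ∃ s₁ : ℝ, 0 < s₁ ∧ ∀ s : ℝ, 0 < s → s ≤ s₁ → ∀ θ : ℝ, 0 < θ → ∀ κ : ℝ, 0 < κ →
        ∀ᶠ N : ℕ in atTop, ∀ L' ∈ Set.Icc (sideLength ρ N) ((1 + κ / N) * sideLength ρ N),
          ∀ Φ : TrialState N L', energy v Φ ≤ groundStateEnergy v N L' + 1 →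
            ∀ a : Fin 3, (∑ j : Fin N, ∫⁻ X in {X : Config N | L' - s < X j a},
                (‖Φ.ψ X‖₊ : ℝ≥0∞) ^ 2) ≤ ENNReal.ofReal (θ * N))
  (hF6 :
    ∀ (S μ η E' E₁ : ℝ) (m p et e : ℝ → ℝ), 0 < μ → 0 ≤ η → E' - E₁ ≤ μ →
      2 * (Real.pi / (2 * Real.sqrt μ)) ≤ S →
      ContinuousOn m (Set.Icc 0 S) → m 0 = 0 → (∀ s ∈ Set.Icc 0 S, 0 ≤ m s) →
      IntegrableOn p (Set.Icc 0 S) → IntegrableOn et (Set.Icc 0 S) → IntegrableOn e (Set.Icc 0 S) →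
      (∀ s ∈ Set.Icc 0 S, m s = ∫ x in (0 : ℝ)..s, p x) →
      (∀ᵐ s ∂(volume.restrict (Set.Icc 0 S)), 0 ≤ et s ∧ et s ≤ e s ∧ p s ^ 2 ≤ 4 * m s * et s) →
      (∀ g : ℝ → ℝ, ContDiff ℝ 1 g →
        (∫ s in (0 : ℝ)..S, g s * e s) + (1 / 2) * (∫ s in (0 : ℝ)..S, deriv g s * p s) =
          E' * ∫ s in (0 : ℝ)..S, g s * m s) →
      (∀ g : ℝ → ℝ, ContDiff ℝ 1 g → (∀ s, 0 ≤ g s) →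
        (∫ s in (0 : ℝ)..S, g s * et s) + E₁ * (∫ s in (0 : ℝ)..S, g s * m s) ≤
          ∫ s in (0 : ℝ)..S, g s * e s) →
      (∫ s in (0 : ℝ)..(2 * (Real.pi / (2 * Real.sqrt μ))), m s) ≤ η →
      ∀ σ : ℝ, 0 < σ → σ ≤ Real.pi / (2 * Real.sqrt μ) / 2 →
        (∫ s in (0 : ℝ)..σ, et s) ≤ 8 * μ * Real.sqrt μ * η * σ)
  (hG4 :
    ∀ (v : ℝ → ℝ≥0∞), Measurable v → ∀ (n : ℕ) (L : ℝ), 0 < L →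
      groundStateEnergy v (n + 1) L ≠ ⊤ → groundStateEnergy v n L ≠ ⊤ →
      ∃ (m p et e : Fin 3 → ℝ → ℝ),
        (∀ a : Fin 3,
          ContinuousOn (m a) (Set.Icc 0 L) ∧ m a 0 = 0 ∧ (∀ s ∈ Set.Icc 0 L, 0 ≤ m a s) ∧
          IntegrableOn (p a) (Set.Icc 0 L) ∧ IntegrableOn (et a) (Set.Icc 0 L) ∧
          IntegrableOn (e a) (Set.Icc 0 L) ∧
          (∀ s ∈ Set.Icc 0 L, m a s = ∫ x in (0 : ℝ)..s, p a x) ∧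
          (∀ᵐ s ∂(volume.restrict (Set.Icc 0 L)),
            0 ≤ et a s ∧ et a s ≤ e a s ∧ p a s ^ 2 ≤ 4 * m a s * et a s) ∧
          (∀ g : ℝ → ℝ, ContDiff ℝ 1 g →
            (∫ s in (0 : ℝ)..L, g s * e a s) + (1 / 2) * (∫ s in (0 : ℝ)..L, deriv g s * p a s) =
              (groundStateEnergy v (n + 1) L).toReal * ∫ s in (0 : ℝ)..L, g s * m a s) ∧
          (∀ g : ℝ → ℝ, ContDiff ℝ 1 g → (∀ s, 0 ≤ g s) →
            (∫ s in (0 : ℝ)..L, g s * et a s) +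
                (groundStateEnergy v n L).toReal * (∫ s in (0 : ℝ)..L, g s * m a s) ≤
              ∫ s in (0 : ℝ)..L, g s * e a s) ∧
          (∀ b ∈ Set.Icc 0 L, ∀ K : ℝ,
            (∀ Φ : TrialState (n + 1) L, energy v Φ ≤ groundStateEnergy v (n + 1) L + 1 →
              (∫ s in (0 : ℝ)..b, marginalMassReal Φ.ψ ((0 : Fin (n + 1)), a) (L - s)) ≤ K) →
            (∫ s in (0 : ℝ)..b, m a s) ≤ K)) ∧
        (∀ σ ∈ Set.Icc 0 L, ∀ θ : ℝ, 0 < θ → ∃ Φ : TrialState (n + 1) L,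
          energy v Φ ≤ groundStateEnergy v (n + 1) L + ENNReal.ofReal θ ∧
          ∀ a : Fin 3, (∫ s in (0 : ℝ)..σ, sliceEnergyReal v Φ.ψ ((0 : Fin (n + 1)), a) (L - s)) ≤
            (∫ s in (0 : ℝ)..σ, e a s) + θ))
  (hG5 :
    ∀ (S E' A s₁ : ℝ) (m p et e : ℝ → ℝ), 0 ≤ E' → 0 ≤ A → 0 < s₁ → s₁ ≤ S →
      ContinuousOn m (Set.Icc 0 S) → m 0 = 0 → (∀ s ∈ Set.Icc 0 S, 0 ≤ m s) →
      IntegrableOn p (Set.Icc 0 S) → IntegrableOn et (Set.Icc 0 S) → IntegrableOn e (Set.Icc 0 S) →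
      (∀ s ∈ Set.Icc 0 S, m s = ∫ x in (0 : ℝ)..s, p x) →
      (∀ᵐ s ∂(volume.restrict (Set.Icc 0 S)), 0 ≤ et s ∧ et s ≤ e s ∧ p s ^ 2 ≤ 4 * m s * et s) →
      (∀ g : ℝ → ℝ, ContDiff ℝ 1 g →
        (∫ s in (0 : ℝ)..S, g s * e s) + (1 / 2) * (∫ s in (0 : ℝ)..S, deriv g s * p s) =
          E' * ∫ s in (0 : ℝ)..S, g s * m s) →
      (∀ σ : ℝ, 0 < σ → σ ≤ s₁ → (∫ s in (0 : ℝ)..σ, et s) ≤ A * σ) →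
      ∀ σ : ℝ, 0 < σ → 2 * σ ≤ s₁ → (∫ s in (0 : ℝ)..σ, e s) ≤ 12 * A * σ + 32 * E' * A * σ ^ 3)

/-! ### Finiteness of the energy at low density from the insertion bound -/

include hF3 in
/-- Iterating the insertion bound from `E₀(0, L) = 0`: at density `N R₀³ ≤ L³/2000` every
`E₀(k, L)`, `k ≤ N + 1`, is finite. -/
theorem groundStateEnergy_ne_top_of_insertionBound {v : ℝ → ℝ≥0∞}
    (hv : Measurable v) {R₀ : ℝ} (hR₀ : 0 < R₀) (hv0 : ∀ r, R₀ < r → v r = 0) {L : ℝ} (hL : 0 < L)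
    (h8 : 8 * R₀ ≤ L) (N : ℕ) (hdens : (N : ℝ) * R₀ ^ 3 ≤ L ^ 3 / 2000) :
    ∀ k : ℕ, k ≤ N + 1 → groundStateEnergy v k L ≠ ⊤ := by
  intro k
  induction k with
  | zero =>
    intro _
    rw [groundStateEnergy_eq_infEnergy, infEnergy_zero]
    exact ENNReal.zero_ne_top
  | succ k ih =>
    intro hk
    have hk' : k ≤ N + 1 := Nat.le_of_succ_le hk
    have hkN : (k : ℝ) * R₀ ^ 3 ≤ L ^ 3 / 2000 := by
      have : (k : ℝ) ≤ N := by exact_mod_cast Nat.lt_succ_iff.1 hk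
      nlinarith [pow_pos hR₀ 3]
    have h := hF3 v hv R₀ hR₀ hv0 k L hL h8 hkN
    exact ne_top_of_le_ne_top (ENNReal.add_ne_top.2 ⟨ih hk', ENNReal.ofReal_ne_top⟩) h


/-! ### From the slab bound of all particles to the wall-coordinate mass of particle `0` -/

/-- If the total expected number of particles within `s` of the right `a`-wall is `≤ θ(n+1)`, then the
wall-coordinate marginal mass of particle `0` integrates to `≤ θ` over `[0, s]`. [folklore] -/
theorem intervalIntegral_marginal_le_of_slab {n : ℕ} {L : ℝ} (Φ : TrialState (n + 1) L) (a : Fin 3)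
    {s θ : ℝ} (hs : 0 ≤ s) (hθ : 0 ≤ θ)
    (h : (∑ j : Fin (n + 1), ∫⁻ X in {X : Config (n + 1) | L - s < X j a}, (‖Φ.ψ X‖₊ : ℝ≥0∞) ^ 2) ≤
      ENNReal.ofReal (θ * (n + 1 : ℕ))) :
    (∫ x in (0 : ℝ)..s, marginalMassReal Φ.ψ ((0 : Fin (n + 1)), a) (L - x)) ≤ θ := by
  have hsum : (∑ j : Fin (n + 1), ∫⁻ X in {X : Config (n + 1) | L - s < X j a}, (‖Φ.ψ X‖₊ : ℝ≥0∞) ^ 2) =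
      ((n + 1 : ℕ) : ℝ≥0∞) * ∫⁻ X in {X : Config (n + 1) | L - s < X (0 : Fin (n + 1)) a},
        (‖Φ.ψ X‖₊ : ℝ≥0∞) ^ 2 := by
    rw [Finset.sum_congr rfl fun j _ => setLIntegral_normSq_coord_eq Φ j 0 a (L - s),
      Finset.sum_const, Finset.card_univ, Fintype.card_fin, nsmul_eq_mul]
  rw [hsum, ENNReal.ofReal_mul hθ, ENNReal.ofReal_natCast, mul_comm (ENNReal.ofReal θ)] at h
  have hN0 : ((n + 1 : ℕ) : ℝ≥0∞) ≠ 0 := by exact_mod_cast Nat.succ_ne_zero n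
  have hNt : ((n + 1 : ℕ) : ℝ≥0∞) ≠ ⊤ := ENNReal.natCast_ne_top _
  have h' : ∫⁻ X in {X : Config (n + 1) | L - s < X (0 : Fin (n + 1)) a}, (‖Φ.ψ X‖₊ : ℝ≥0∞) ^ 2 ≤
      ENNReal.ofReal θ := (ENNReal.mul_le_mul_iff_right hN0 hNt).1 (by simpa [mul_comm] using h)
  rw [setLIntegral_normSq_eq_ofReal Φ ((0 : Fin (n + 1)), a) hs] at h'
  exact (ENNReal.ofReal_le_ofReal_iff hθ).1 h'

/-! ### The assembly: R3 from F3, F4, F6, G4, G5 -/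

/-- Bookkeeping of the constants (pure real arithmetic). With `θ = ερ/(1728κμ√μ)`, `A = 8μ√μθ`,
`θtr = ερw/(9κ)`, `Q = 24Aw + 256E'Aw³ + θtr` and `32(E'+1)w² ≤ 1`: `3(n+1)Q ≤ ερ(n+1)w/κ` and
`θtr ≤ ερ(n+1)w/κ`. [folklore] -/
theorem nearWall_budget {ε ρ κ μ E' w : ℝ} {m : ℕ} (hε : 0 < ε) (hρ : 0 < ρ) (hκ : 0 < κ)
    (hμ : 0 < μ) (hw : 0 < w) (hw2 : w ^ 2 * (32 * (E' + 1)) ≤ 1) (hm : 1 ≤ (m : ℝ)) :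
    3 * (m : ℝ) * (12 * (8 * μ * Real.sqrt μ * (ε * ρ / (1728 * κ * μ * Real.sqrt μ))) * (2 * w) +
        32 * E' * (8 * μ * Real.sqrt μ * (ε * ρ / (1728 * κ * μ * Real.sqrt μ))) * (2 * w) ^ 3 +
        ε * ρ * w / (9 * κ)) ≤ ε * ρ * m * w / κ ∧
      ε * ρ * w / (9 * κ) ≤ ε * ρ * m * w / κ := by
  have hsμ : 0 < Real.sqrt μ := Real.sqrt_pos.2 hμ
  have hA : 8 * μ * Real.sqrt μ * (ε * ρ / (1728 * κ * μ * Real.sqrt μ)) = ε * ρ / (216 * κ) := by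
    field_simp; ring
  rw [hA]
  have hE'w : 32 * (E' * w ^ 2) ≤ 1 := by
    have := hw2; ring_nf at this ⊢; nlinarith [sq_nonneg w]
  have hunit : 0 < ε * ρ * w / κ := by positivity
  constructor
  · have hexp : 3 * (m : ℝ) * (12 * (ε * ρ / (216 * κ)) * (2 * w) +
        32 * E' * (ε * ρ / (216 * κ)) * (2 * w) ^ 3 + ε * ρ * w / (9 * κ)) =
        (m : ℝ) * (ε * ρ * w / κ) * (2 / 3 + 32 / 9 * (E' * w ^ 2)) := by
      field_simp; ring
    rw [hexp]
    have h1 : 2 / 3 + 32 / 9 * (E' * w ^ 2) ≤ 1 := by nlinarith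
    calc (m : ℝ) * (ε * ρ * w / κ) * (2 / 3 + 32 / 9 * (E' * w ^ 2))
        ≤ (m : ℝ) * (ε * ρ * w / κ) * 1 := by
          apply mul_le_mul_of_nonneg_left h1; positivity
      _ = ε * ρ * m * w / κ := by ring
  · rw [div_le_div_iff₀ (by positivity) hκ]
    have h0 : 0 ≤ ε * ρ * w := by positivity
    nlinarith [mul_le_mul_of_nonneg_left hm h0]

include hF6 hG4 hG5 in
/-- **The fixed-box step.** In a box `L'` with finite energies of `n` and `n+1` particles, given the
limit package, the Sturm package, the full-slice-energy bound, the chemical-potential bound `E'-E₁ ≤ μ`,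
the slab bound at width `2s₀` with tolerance `θ`, and `2s₀ ≤ L'`, every small `w` admits a near-minimiser
with small near-wall energy. [folklore] -/
theorem nearWall_fixed_box
    {v : ℝ → ℝ≥0∞} (hv : Measurable v) {n : ℕ} {L' μ θ B : ℝ} (hL' : 0 < L') (hμ : 0 < μ) (hθ : 0 < θ)
    (hB : 0 < B)
    (hfinN : groundStateEnergy v (n + 1) L' ≠ ⊤) (hfinn : groundStateEnergy v n L' ≠ ⊤)
    (hE'E₁ : (groundStateEnergy v (n + 1) L').toReal - (groundStateEnergy v n L').toReal ≤ μ)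
    (h2s₀ : 2 * (Real.pi / (2 * Real.sqrt μ)) ≤ L')
    (hslab : ∀ Φ : TrialState (n + 1) L', energy v Φ ≤ groundStateEnergy v (n + 1) L' + 1 →
      ∀ a : Fin 3, (∑ j : Fin (n + 1), ∫⁻ X in {X : Config (n + 1) | L' - 2 * (Real.pi / (2 * Real.sqrt μ)) < X j a},
        (‖Φ.ψ X‖₊ : ℝ≥0∞) ^ 2) ≤ ENNReal.ofReal (θ * (n + 1 : ℕ)))
    (hbudget : ∀ w : ℝ, 0 < w → w ^ 2 * (32 * ((groundStateEnergy v (n + 1) L').toReal + 1)) ≤ 1 →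
      3 * ((n + 1 : ℕ) : ℝ) * (12 * (8 * μ * Real.sqrt μ * θ) * (2 * w) +
        32 * (groundStateEnergy v (n + 1) L').toReal * (8 * μ * Real.sqrt μ * θ) * (2 * w) ^ 3 +
          B * w / 9) ≤ B * (n + 1 : ℕ) * w ∧ B * w / 9 ≤ B * (n + 1 : ℕ) * w) :
    ∃ w₀ : ℝ, 0 < w₀ ∧ ∀ w ∈ Set.Ioc (0 : ℝ) w₀, ∃ u : TrialState (n + 1) L',
      energy v u ≤ groundStateEnergy v (n + 1) L' + ENNReal.ofReal (B * (n + 1 : ℕ) * w) ∧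
      (∑ j : Fin (n + 1), ∑ a : Fin 3, ∫⁻ X in {X : Config (n + 1) | L' - 2 * w < X j a},
          (kineticDensity u.ψ X + interaction v X * (‖u.ψ X‖₊ : ℝ≥0∞) ^ 2)) ≤
        ENNReal.ofReal (B * (n + 1 : ℕ) * w) := by
  have hE'nn : 0 ≤ (groundStateEnergy v (n + 1) L').toReal := ENNReal.toReal_nonneg
  have hs₀pos : 0 < Real.pi / (2 * Real.sqrt μ) := by positivity
  obtain ⟨m, p, et, e, hdata, htr⟩ := hG4 v hv n L' hL' hfinN hfinn
  have hAnn : 0 ≤ 8 * μ * Real.sqrt μ * θ := by positivity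
  -- F6 per direction
  have hEt : ∀ a : Fin 3, ∀ σ' : ℝ, 0 < σ' → σ' ≤ Real.pi / (2 * Real.sqrt μ) / 2 →
      (∫ s in (0 : ℝ)..σ', et a s) ≤ 8 * μ * Real.sqrt μ * θ * σ' := by
    intro a σ' hσ' hσ's
    obtain ⟨hC1, h0, hnn, hIp, hIet, hIe, hC3, hC4, hC5, hC6, hC7⟩ := hdata a
    have hmass : (∫ s in (0 : ℝ)..(2 * (Real.pi / (2 * Real.sqrt μ))), m a s) ≤ θ :=
      hC7 (2 * (Real.pi / (2 * Real.sqrt μ))) ⟨by positivity, h2s₀⟩ θ fun Φ hΦ =>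
        intervalIntegral_marginal_le_of_slab Φ a (by positivity) hθ.le (hslab Φ hΦ a)
    exact hF6 L' μ θ _ _ (m a) (p a) (et a) (e a) hμ hθ.le hE'E₁ h2s₀ hC1 h0 hnn hIp hIet hIe hC3 hC4
      hC5 hC6 hmass σ' hσ' hσ's
  refine ⟨min (Real.pi / (2 * Real.sqrt μ) / 8)
      (min (1 / Real.sqrt (32 * ((groundStateEnergy v (n + 1) L').toReal + 1))) (L' / 4)),
    by positivity, fun w hw => ?_⟩
  have hw0 : 0 < w := hw.1
  have hws₀ : w ≤ Real.pi / (2 * Real.sqrt μ) / 8 := hw.2.trans (min_le_left _ _)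
  have hwE : w ≤ 1 / Real.sqrt (32 * ((groundStateEnergy v (n + 1) L').toReal + 1)) :=
    hw.2.trans ((min_le_right _ _).trans (min_le_left _ _))
  have hwL : w ≤ L' / 4 := hw.2.trans ((min_le_right _ _).trans (min_le_right _ _))
  have hw2 : w ^ 2 * (32 * ((groundStateEnergy v (n + 1) L').toReal + 1)) ≤ 1 := by
    have hs : 0 < Real.sqrt (32 * ((groundStateEnergy v (n + 1) L').toReal + 1)) :=
      Real.sqrt_pos.2 (by positivity)
    have h1 : w * Real.sqrt (32 * ((groundStateEnergy v (n + 1) L').toReal + 1)) ≤ 1 := by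
      rwa [le_div_iff₀ hs] at hwE
    have h2 : 0 ≤ w * Real.sqrt (32 * ((groundStateEnergy v (n + 1) L').toReal + 1)) := by positivity
    calc w ^ 2 * (32 * ((groundStateEnergy v (n + 1) L').toReal + 1))
        = (w * Real.sqrt (32 * ((groundStateEnergy v (n + 1) L').toReal + 1))) ^ 2 := by
          rw [mul_pow, Real.sq_sqrt (by positivity)]
      _ ≤ 1 := by nlinarith
  obtain ⟨hQ, hθtr⟩ := hbudget w hw0 hw2
  -- G5 per direction at `σ = 2w`
  have hEfull : ∀ a : Fin 3, (∫ s in (0 : ℝ)..(2 * w), e a s) ≤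
      12 * (8 * μ * Real.sqrt μ * θ) * (2 * w) +
        32 * (groundStateEnergy v (n + 1) L').toReal * (8 * μ * Real.sqrt μ * θ) * (2 * w) ^ 3 := by
    intro a
    obtain ⟨hC1, h0, hnn, hIp, hIet, hIe, hC3, hC4, hC5, -, -⟩ := hdata a
    exact hG5 L' _ _ (Real.pi / (2 * Real.sqrt μ) / 2) (m a) (p a) (et a) (e a) hE'nn hAnn
      (by positivity) (by linarith) hC1 h0 hnn hIp hIet hIe hC3 hC4 hC5 (hEt a) (2 * w)
      (by positivity) (by linarith)
  -- transfer
  have hθtrpos : 0 < B * w / 9 := by positivity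
  obtain ⟨Φ, hΦE, hΦe⟩ := htr (2 * w) ⟨by positivity, by linarith⟩ (B * w / 9) hθtrpos
  have hfinΦ : energy v Φ ≠ ⊤ :=
    ne_top_of_le_ne_top (ENNReal.add_ne_top.2 ⟨hfinN, ENNReal.ofReal_ne_top⟩) hΦE
  refine ⟨Φ, hΦE.trans (add_le_add le_rfl (ENNReal.ofReal_le_ofReal hθtr)), ?_⟩
  have hterm : ∀ a : Fin 3, ∫⁻ X in {X : Config (n + 1) | L' - 2 * w < X (0 : Fin (n + 1)) a},
      (kineticDensity Φ.ψ X + interaction v X * (‖Φ.ψ X‖₊ : ℝ≥0∞) ^ 2) ≤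
      ENNReal.ofReal (12 * (8 * μ * Real.sqrt μ * θ) * (2 * w) +
        32 * (groundStateEnergy v (n + 1) L').toReal * (8 * μ * Real.sqrt μ * θ) * (2 * w) ^ 3 +
          B * w / 9) := by
    intro a
    rw [setLIntegral_energyDensity_eq_ofReal hv Φ hfinΦ ((0 : Fin (n + 1)), a) (by positivity)]
    refine ENNReal.ofReal_le_ofReal ?_
    linarith [hΦe a, hEfull a]
  calc (∑ j : Fin (n + 1), ∑ a : Fin 3, ∫⁻ X in {X : Config (n + 1) | L' - 2 * w < X j a},
          (kineticDensity Φ.ψ X + interaction v X * (‖Φ.ψ X‖₊ : ℝ≥0∞) ^ 2))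
      = ∑ j : Fin (n + 1), ∑ a : Fin 3, ∫⁻ X in {X : Config (n + 1) | L' - 2 * w < X (0 : Fin (n + 1)) a},
          (kineticDensity Φ.ψ X + interaction v X * (‖Φ.ψ X‖₊ : ℝ≥0∞) ^ 2) := by
        refine Finset.sum_congr rfl fun j _ => Finset.sum_congr rfl fun a _ => ?_
        exact setLIntegral_energyDensity_coord_eq v hv Φ j 0 a (L' - 2 * w)
    _ ≤ ∑ j : Fin (n + 1), ∑ a : Fin 3, ENNReal.ofReal (12 * (8 * μ * Real.sqrt μ * θ) * (2 * w) +
          32 * (groundStateEnergy v (n + 1) L').toReal * (8 * μ * Real.sqrt μ * θ) * (2 * w) ^ 3 +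
            B * w / 9) := by
        gcongr with j _ a _
        exact hterm a
    _ = ENNReal.ofReal (3 * (n + 1 : ℕ) * (12 * (8 * μ * Real.sqrt μ * θ) * (2 * w) +
          32 * (groundStateEnergy v (n + 1) L').toReal * (8 * μ * Real.sqrt μ * θ) * (2 * w) ^ 3 +
            B * w / 9)) := by
        simp only [Finset.sum_const, Finset.card_univ, Fintype.card_fin, nsmul_eq_mul]
        rw [ENNReal.ofReal_mul (by positivity), ENNReal.ofReal_mul (by norm_num),
          ENNReal.ofReal_natCast, show ENNReal.ofReal 3 = (3 : ℕ) by norm_num]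
        push_cast
        ring
    _ ≤ ENNReal.ofReal (B * (n + 1 : ℕ) * w) := ENNReal.ofReal_le_ofReal hQ

include hF3 hF4 hF6 hG4 hG5 in
/-- **F7 `stub_nearWallGlue` (lead; v8, PROVED).** The near-wall energy bound R3 from the five
inputs: insertion bound (F3), slab non-concentration (F4), the Sturm package (F6), the marginal limit
package (G4) and the full-slice-energy post-processing (G5). Constants: `ρ₀ := min ρ₄ (1/(2000R₀³))`,
`μ := max (13000ρR₀+2) (π²/s₁²+1)`, `s₀ := π/(2√μ)`, `θ := ερ/(1728κμ√μ)`, `A := 8μ√μθ`,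
`w₀ := min (s₀/8) (min (1/√(32(E'+1))) (L'/4))`; eventualities: F4 at `(2s₀, θ, κ)`,
`L_N ≥ max (max 8R₀ 2s₀) √120`, `N ≥ 2`. -/
theorem stub_nearWallGlue :
    ∀ v : ℝ → ℝ≥0∞, IsRepulsiveFiniteRange v → ∃ ρ₀ : ℝ, 0 < ρ₀ ∧ ∀ ρ : ℝ, 0 < ρ → ρ < ρ₀ →
      ∀ ε : ℝ, 0 < ε → ∀ κ : ℝ, 0 < κ → ∀ᶠ N : ℕ in atTop,
        ∀ L' ∈ Set.Icc (sideLength ρ N) ((1 + κ / N) * sideLength ρ N),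
          ∃ w₀ : ℝ, 0 < w₀ ∧ ∀ w ∈ Set.Ioc (0 : ℝ) w₀, ∃ u : TrialState N L',
            energy v u ≤ groundStateEnergy v N L' +
                ENNReal.ofReal (ε * N ^ 2 * w / (κ * sideLength ρ N ^ 3)) ∧
            (∑ j : Fin N, ∑ a : Fin 3, ∫⁻ X in {X : Config N | L' - 2 * w < X j a},
                (kineticDensity u.ψ X + interaction v X * (‖u.ψ X‖₊ : ℝ≥0∞) ^ 2)) ≤
              ENNReal.ofReal (ε * N ^ 2 * w / (κ * sideLength ρ N ^ 3)) := by
  intro v hv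
  obtain ⟨R₀, hR₀, hv0⟩ := hv.exists_pos_range
  obtain ⟨ρ₄, hρ₄, h4⟩ := hF4 v hv
  refine ⟨min ρ₄ (1 / (2000 * R₀ ^ 3)), lt_min hρ₄ (by positivity), fun ρ hρ hρlt ε hε κ hκ => ?_⟩
  have hρ₄' : ρ < ρ₄ := hρlt.trans_le (min_le_left _ _)
  have hρR : ρ * R₀ ^ 3 ≤ 1 / 2000 := by
    have := (hρlt.trans_le (min_le_right _ _)).le
    rw [le_div_iff₀ (by positivity)] at this
    linarith
  obtain ⟨s₁, hs₁, h4'⟩ := h4 ρ hρ hρ₄'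
  -- the comparison constant `μ` and the slab tolerance `θ`
  obtain ⟨μ, hμdef⟩ : ∃ μ : ℝ, μ = max (13000 * ρ * R₀ + 2) (Real.pi ^ 2 / s₁ ^ 2 + 1) := ⟨_, rfl⟩
  have hμpos : 0 < μ := by rw [hμdef]; exact lt_max_of_lt_left (by positivity)
  have hμ1 : 13000 * ρ * R₀ + 2 ≤ μ := by rw [hμdef]; exact le_max_left _ _
  have hμ2 : Real.pi ^ 2 / s₁ ^ 2 + 1 ≤ μ := by rw [hμdef]; exact le_max_right _ _
  have hs₀pos : 0 < Real.pi / (2 * Real.sqrt μ) := by positivity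
  have h2s₀ : 2 * (Real.pi / (2 * Real.sqrt μ)) ≤ s₁ := by
    have hsq : Real.pi / s₁ ≤ Real.sqrt μ := by
      refine Real.le_sqrt_of_sq_le ?_
      have : (Real.pi / s₁) ^ 2 = Real.pi ^ 2 / s₁ ^ 2 := by rw [div_pow]
      linarith
    have hps : 0 < Real.pi / s₁ := by positivity
    calc 2 * (Real.pi / (2 * Real.sqrt μ)) = Real.pi / Real.sqrt μ := by field_simp
      _ ≤ Real.pi / (Real.pi / s₁) := div_le_div_of_nonneg_left Real.pi_pos.le hps hsq
      _ = s₁ := by field_simp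
  obtain ⟨θ, hθdef⟩ : ∃ θ : ℝ, θ = ε * ρ / (1728 * κ * μ * Real.sqrt μ) := ⟨_, rfl⟩
  have hθpos : 0 < θ := by rw [hθdef]; positivity
  have hF4ev := h4' (2 * (Real.pi / (2 * Real.sqrt μ))) (by positivity) h2s₀ θ hθpos κ hκ
  have hLev : ∀ᶠ N : ℕ in atTop,
      max (max (8 * R₀) (2 * (Real.pi / (2 * Real.sqrt μ)))) (Real.sqrt 120) ≤ sideLength ρ N :=
    (tendsto_sideLength_atTop hρ).eventually_ge_atTop _
  filter_upwards [hF4ev, hLev, eventually_ge_atTop 2] with N hN4 hNL hN2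
  obtain ⟨n, rfl⟩ : ∃ n, N = n + 1 := ⟨N - 1, by omega⟩
  intro L' hL'
  have hNpos : 0 < n + 1 := Nat.succ_pos n
  have hLpos : 0 < sideLength ρ (n + 1) := sideLength_pos_of_pos hρ hNpos
  have hLL' : sideLength ρ (n + 1) ≤ L' := hL'.1
  have hL'pos : 0 < L' := hLpos.trans_le hLL'
  have h8R : 8 * R₀ ≤ L' := (((le_max_left _ _).trans (le_max_left _ _)).trans hNL).trans hLL'
  have h2s₀L : 2 * (Real.pi / (2 * Real.sqrt μ)) ≤ L' :=
    (((le_max_right _ _).trans (le_max_left _ _)).trans hNL).trans hLL'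
  have h120 : Real.sqrt 120 ≤ L' := ((le_max_right _ _).trans hNL).trans hLL'
  have hL3 : sideLength ρ (n + 1) ^ 3 = (n + 1 : ℕ) / ρ := sideLength_pow_three hρ (n + 1)
  have hρL3 : ρ * sideLength ρ (n + 1) ^ 3 = (n + 1 : ℕ) := by rw [hL3]; field_simp
  have hL3' : sideLength ρ (n + 1) ^ 3 ≤ L' ^ 3 := pow_le_pow_left₀ hLpos.le hLL' 3
  have hdens : ((n : ℕ) : ℝ) * R₀ ^ 3 ≤ L' ^ 3 / 2000 := by
    have h1 : ((n : ℕ) : ℝ) ≤ (n + 1 : ℕ) := by exact_mod_cast Nat.le_succ n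
    calc ((n : ℕ) : ℝ) * R₀ ^ 3 ≤ (n + 1 : ℕ) * R₀ ^ 3 := by gcongr
      _ = ρ * R₀ ^ 3 * sideLength ρ (n + 1) ^ 3 := by rw [← hρL3]; ring
      _ ≤ 1 / 2000 * L' ^ 3 := by gcongr
      _ = L' ^ 3 / 2000 := by ring
  have hfin := groundStateEnergy_ne_top_of_insertionBound hF3 hv.1 hR₀ hv0 hL'pos h8R n hdens
  have hfinN : groundStateEnergy v (n + 1) L' ≠ ⊤ := hfin (n + 1) le_rfl
  have hfinn : groundStateEnergy v n L' ≠ ⊤ := hfin n (Nat.le_succ n)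
  -- chemical-potential bound
  have hE'E₁ : (groundStateEnergy v (n + 1) L').toReal - (groundStateEnergy v n L').toReal ≤ μ := by
    have h := hF3 v hv.1 R₀ hR₀ hv0 n L' hL'pos h8R hdens
    have hb0 : 0 ≤ 120 / L' ^ 2 + 13000 * n * R₀ / L' ^ 3 := by positivity
    have h' : (groundStateEnergy v (n + 1) L').toReal ≤
        (groundStateEnergy v n L').toReal + (120 / L' ^ 2 + 13000 * n * R₀ / L' ^ 3) := by
      have := ENNReal.toReal_mono (ENNReal.add_ne_top.2 ⟨hfinn, ENNReal.ofReal_ne_top⟩) h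
      rwa [ENNReal.toReal_add hfinn ENNReal.ofReal_ne_top, ENNReal.toReal_ofReal hb0] at this
    have hb1 : 120 / L' ^ 2 ≤ 1 := by
      rw [div_le_one (by positivity)]
      have : (120 : ℝ) = Real.sqrt 120 ^ 2 := (Real.sq_sqrt (by norm_num)).symm
      rw [this]
      exact pow_le_pow_left₀ (Real.sqrt_nonneg _) h120 2
    have hb2 : 13000 * n * R₀ / L' ^ 3 ≤ 13000 * ρ * R₀ := by
      rw [div_le_iff₀ (by positivity)]
      have : (n : ℝ) ≤ ρ * L' ^ 3 := by
        have h1 : ((n : ℕ) : ℝ) ≤ (n + 1 : ℕ) := by exact_mod_cast Nat.le_succ n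
        calc (n : ℝ) ≤ (n + 1 : ℕ) := h1
          _ = ρ * sideLength ρ (n + 1) ^ 3 := hρL3.symm
          _ ≤ ρ * L' ^ 3 := by gcongr
      nlinarith [hR₀]
    linarith
  -- apply the fixed-box step with `B = ερ/κ`
  have hB : 0 < ε * ρ / κ := by positivity
  have hbudget := fun w (hw0 : 0 < w)
      (hw2 : w ^ 2 * (32 * ((groundStateEnergy v (n + 1) L').toReal + 1)) ≤ 1) =>
    nearWall_budget (m := n + 1) hε hρ hκ hμpos hw0 hw2 (by exact_mod_cast hNpos)
  obtain ⟨w₀, hw₀, hmain⟩ := nearWall_fixed_box hF6 hG4 hG5 hv.1 hL'pos hμpos hθpos hB hfinN hfinn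
    hE'E₁ h2s₀L (fun Φ hΦ a => hN4 L' hL' Φ hΦ a) (fun w hw0 hw2 => by
      have := hbudget w hw0 hw2
      rw [hθdef]
      constructor
      · convert this.1 using 2 <;> ring
      · convert this.2 using 1 <;> ring)
  refine ⟨w₀, hw₀, fun w hw => ?_⟩
  obtain ⟨u, hu1, hu2⟩ := hmain w hw
  have hconv : ENNReal.ofReal (ε * ρ / κ * (n + 1 : ℕ) * w) =
      ENNReal.ofReal (ε * (n + 1 : ℕ) ^ 2 * w / (κ * sideLength ρ (n + 1) ^ 3)) := by
    congr 1
    rw [hL3]; field_simp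
  rw [hconv] at hu1 hu2
  exact ⟨u, hu1, hu2⟩

end Glue


/-! ## R3 — the near-wall energy bound (OPEN, load-bearing: the wall flux is `o(N)`) -/

/-- **R3 `stub_nearWallEnergy` (load-bearing; DERIVED (v8) from F3, F4, F6, G4, G5 via the glue F7).** For every repulsive finite-range `v`, at all small
`ρ`, for all `ε, κ > 0`, eventually in `N`, for every box `L' ∈ [L_N, (1+κ/N)L_N]` there is `w₀ > 0` such
that for every `0 < w ≤ w₀` some near-minimiser `u` of the box `L'` (energy `≤ E₀(N,L') + w·εN²/(κL_N³)`)
carries energy `∑_{j,a}∫_{x_{j,a} > L'-2w}(|∇u|² + ∑v|u|²) ≤ w·εN²/(κL_N³)` in the configurations with a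
particle coordinate within `2w` of its right wall. Equivalently (Hadamard): the wall flux
`F(L') = ∑_{j,a}∫_{x_{j,a}=L'}|∂_{j,a}Ψ₀|² = -dE₀/dL'` of the ground state is `≤ (ε/κ)ρN = o(N)`, uniformly on
the window, against the thermodynamic value `3pL'² ≈ 12πaρN/L'`. Why plausibly true: margin `N^{1/3}`; the
local virial identity for the one-coordinate marginal of `Ψ₀`, Sturm comparison, the insertion bound
`μ_N ≤ O(ρR₀)` and slab non-concentration give `F ≤ (12/π)Nμ̄^{3/2}η_N` with `η_N → 0` for every `v` with a
repulsive core (hard cores included) — modulo ground-state regularity not in the tree. Why it might fail: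
a boundary layer of the Dirichlet ground state carrying energy `≳ N^{1/3}` per unit... i.e. wall pressure
`≳ ρN` for some admissible `v` (a hollow potential with clusters plated on the wall?). Size: the crux's
open core (XL). Sources: Hadamard 1908; LSSY2005 Thm 2.2; Lieb–Yngvason 1998. -/
theorem stub_nearWallEnergy :
    ∀ v : ℝ → ℝ≥0∞, IsRepulsiveFiniteRange v → ∃ ρ₀ : ℝ, 0 < ρ₀ ∧ ∀ ρ : ℝ, 0 < ρ → ρ < ρ₀ →
      ∀ ε : ℝ, 0 < ε → ∀ κ : ℝ, 0 < κ → ∀ᶠ N : ℕ in atTop,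
        ∀ L' ∈ Set.Icc (sideLength ρ N) ((1 + κ / N) * sideLength ρ N),
          ∃ w₀ : ℝ, 0 < w₀ ∧ ∀ w ∈ Set.Ioc (0 : ℝ) w₀, ∃ u : TrialState N L',
            energy v u ≤ groundStateEnergy v N L' +
                ENNReal.ofReal (ε * N ^ 2 * w / (κ * sideLength ρ N ^ 3)) ∧
            (∑ j : Fin N, ∑ a : Fin 3, ∫⁻ X in {X : Config N | L' - 2 * w < X j a},
                (kineticDensity u.ψ X + interaction v X * (‖u.ψ X‖₊ : ℝ≥0∞) ^ 2)) ≤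
              ENNReal.ofReal (ε * N ^ 2 * w / (κ * sideLength ρ N ^ 3)) :=
  stub_nearWallGlue (stub_insertionBound stub_firstVariation) stub_slabNonConcentration stub_sturmPackage
    stub_marginalLimit stub_fullSliceEnergy1D

/-! ## R4 — the chaining lemma (pure real analysis; PROVABLE) -/

/-- **`stub_slopeChain`** (real analysis; size S; LANDED p157972). Let `g : ℝ → ℝ`, `a ≤ b`, `B ≥ 0`. If at every
`t ∈ [a, b)` the function does not jump down to the right (`∀ η > 0`, `g t ≤ g (t + w) + η` for all small
`w > 0`) and at every `t ∈ (a, b]` it has left increments `g (t - w) ≤ g t + B w` for all small `w > 0`, then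
`g a ≤ g b + B (b - a)`. Proof: the set `S = {t ∈ [a,b] : g t ≤ g b + B (b - t)}` contains `b`; its infimum
`t⋆` belongs to `S` by the first hypothesis (approach `t⋆` by points of `S` from the right), and `t⋆ > a`
would put `t⋆ - w ∈ S` by the second. [folklore] -/
theorem stub_slopeChain :
    ∀ (g : ℝ → ℝ) (a b B : ℝ), a ≤ b → 0 ≤ B →
      (∀ t ∈ Set.Ico a b, ∀ η : ℝ, 0 < η → ∃ w₀ : ℝ, 0 < w₀ ∧
          ∀ w : ℝ, 0 < w → w < w₀ → t + w ≤ b → g t ≤ g (t + w) + η) →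
      (∀ t ∈ Set.Ioc a b, ∃ w₀ : ℝ, 0 < w₀ ∧
          ∀ w : ℝ, 0 < w → w ≤ w₀ → a ≤ t - w → g (t - w) ≤ g t + B * w) →
      g a ≤ g b + B * (b - a) :=
  -- LANDED p157972
  Summit.AtomisticToContinuum.BoseEinsteinCondensation.Theorems.RigidMomentumBound.stub_slopeChain

/-! ## Assembly A — displacement softness S4 from R1–R4 and S1 (sorry-free) -/

/-- Elementary real-arithmetic step of the assembly: from `X (1 - 4 w³ B₀) ≤ E + 101 B₀ w` with
`0 ≤ X`, `0 ≤ E`, `0 < B₀`, `0 < w ≤ 1`, `4 w E ≤ 51`, `816 w B₀ ≤ 52` conclude `X ≤ E + 204 B₀ w`. -/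
theorem slope_arith {X E B₀ w : ℝ} (hB₀ : 0 < B₀) (hw : 0 < w) (hw1 : w ≤ 1)
    (hwE : 4 * w * E ≤ 51) (hwB : 816 * w * B₀ ≤ 52)
    (h : X * (1 - 4 * w ^ 3 * B₀) ≤ E + 101 * B₀ * w) : X ≤ E + 204 * B₀ * w := by
  have hw2 : w ^ 2 ≤ w := by nlinarith
  have hw3 : w ^ 3 ≤ w := by nlinarith
  have hc : 4 * w ^ 3 * B₀ ≤ 52 / 204 := by nlinarith
  have hpos : 0 < 1 - 4 * w ^ 3 * B₀ := by linarith
  -- it suffices that `E + 101 B₀ w ≤ (E + 204 B₀ w)(1 - 4w³B₀)`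
  have key : E + 101 * B₀ * w ≤ (E + 204 * B₀ * w) * (1 - 4 * w ^ 3 * B₀) := by
    have h1 : 4 * w ^ 3 * B₀ * E ≤ 51 * B₀ * w := by
      have : 4 * w ^ 3 * B₀ * E = (4 * w * E) * (w ^ 2) * B₀ := by ring
      rw [this]
      have : (4 * w * E) * w ^ 2 * B₀ ≤ 51 * w ^ 2 * B₀ := by gcongr
      nlinarith [mul_pos hB₀ hw]
    have h2 : 204 * B₀ * w * (4 * w ^ 3 * B₀) ≤ 52 * B₀ * w := by
      have : 204 * B₀ * w * (4 * w ^ 3 * B₀) = (816 * w * B₀) * w ^ 2 * (B₀ * w) := by ring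
      rw [this]
      have : (816 * w * B₀) * w ^ 2 * (B₀ * w) ≤ 52 * w ^ 2 * (B₀ * w) := by
        gcongr
      nlinarith [mul_pos hB₀ hw]
    nlinarith
  by_contra hlt
  rw [not_le] at hlt
  have : (E + 204 * B₀ * w) * (1 - 4 * w ^ 3 * B₀) < X * (1 - 4 * w ^ 3 * B₀) :=
    mul_lt_mul_of_pos_right hlt hpos
  linarith

/-- **S4 `stub_displacementSoftness`, DERIVED** (was the open stub of v3/v4): for every repulsive
finite-range `v`, at all small `ρ`, for all `ε, κ > 0`, eventually in `N`,
`E₀(N, L_N) ≤ E₀(N, (1 + κ/N)·L_N) + ε N/L_N²`. Proof: with `g(t) = E₀(N,t)` (finite on `[L_N, ∞)` by S1 and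
monotonicity) apply `stub_slopeChain` on `[L_N, (1+κ/N)L_N]` with slope `B = εN²/(κL_N³)`: the right
no-jump hypothesis is `stub_boxEnergyRightContinuous`; the left-increment hypothesis is `stub_shrinkBound`
fed with the near-minimisers of `stub_nearWallEnergy` (at `ε/204`), after clearing the normalisation factor
`1 - 4w³B₀ ≥ 150/204` (`slope_arith`); finally `B·(κL_N/N) = εN/L_N²`. -/
theorem stub_displacementSoftness :
    ∀ v : ℝ → ℝ≥0∞, IsRepulsiveFiniteRange v → ∃ ρ₀ : ℝ, 0 < ρ₀ ∧ ∀ ρ : ℝ, 0 < ρ → ρ < ρ₀ →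
      ∀ ε : ℝ, 0 < ε → ∀ κ : ℝ, 0 < κ → ∀ᶠ N : ℕ in atTop,
        groundStateEnergy v N (sideLength ρ N) ≤
          groundStateEnergy v N ((1 + κ / N) * sideLength ρ N) +
            ENNReal.ofReal (ε * N / sideLength ρ N ^ 2) := by
  intro v hv
  obtain ⟨ρ₁, hρ₁, h₁⟩ := stub_dirichletEnergyLinear v hv
  obtain ⟨ρ₅, hρ₅, h₅⟩ := stub_nearWallEnergy v hv
  refine ⟨min ρ₁ ρ₅, lt_min hρ₁ hρ₅, fun ρ hρ hρlt ε hε κ hκ => ?_⟩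
  obtain ⟨C, _, hE₀⟩ := h₁ ρ hρ (hρlt.trans_le (min_le_left _ _))
  have hW := h₅ ρ hρ (hρlt.trans_le (min_le_right _ _)) (ε / 204) (by positivity) κ hκ
  filter_upwards [hE₀, hW, eventually_gt_atTop 0] with N hN₁ hN₅ hN0
  have hNpos : (0 : ℝ) < N := Nat.cast_pos.2 hN0
  set L : ℝ := sideLength ρ N with hLdef
  have hLpos : 0 < L := sideLength_pos_of_pos hρ hN0
  set Lp : ℝ := (1 + κ / N) * L with hLpdef
  have hκN : 0 < κ / N := div_pos hκ hNpos
  have hLLp : L ≤ Lp := by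
    rw [hLpdef]; nlinarith
  -- finiteness of `E₀(N, t)` for `t ≥ L`
  have hfin : ∀ t : ℝ, L ≤ t → groundStateEnergy v N t ≠ ⊤ := fun t ht =>
    ne_top_of_le_ne_top ENNReal.ofReal_ne_top ((groundStateEnergy_anti v N ht).trans hN₁)
  -- the real-valued energy and the slope
  set g : ℝ → ℝ := fun t => (groundStateEnergy v N t).toReal with hgdef
  set B₀ : ℝ := ε / 204 * N ^ 2 / (κ * L ^ 3) with hB₀def
  have hB₀ : 0 < B₀ := by positivity
  set B : ℝ := 204 * B₀ with hBdef
  have hB : 0 ≤ B := by positivity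
  -- hypothesis 1 of the chain: no downward jump to the right (R2)
  have hright : ∀ t ∈ Set.Ico L Lp, ∀ η : ℝ, 0 < η → ∃ w₀ : ℝ, 0 < w₀ ∧
      ∀ w : ℝ, 0 < w → w < w₀ → t + w ≤ Lp → g t ≤ g (t + w) + η := by
    intro t ht η hη
    obtain ⟨w₀, hw₀, hw⟩ :=
      stub_boxEnergyRightContinuous v hv N t (hLpos.trans_le ht.1) (hfin t ht.1) η hη
    refine ⟨w₀, hw₀, fun w hw0 hww _ => ?_⟩
    have h := hw w hw0 hww
    have ht1 : groundStateEnergy v N (t + w) ≠ ⊤ := hfin (t + w) (by linarith [ht.1])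
    have h2 : (groundStateEnergy v N t).toReal ≤
        (groundStateEnergy v N (t + w) + ENNReal.ofReal η).toReal :=
      ENNReal.toReal_mono (ENNReal.add_ne_top.2 ⟨ht1, ENNReal.ofReal_ne_top⟩) h
    rw [ENNReal.toReal_add ht1 ENNReal.ofReal_ne_top, ENNReal.toReal_ofReal hη.le] at h2
    exact h2
  -- hypothesis 2 of the chain: left increments `≤ B w` (R1 + R3)
  have hslope : ∀ t ∈ Set.Ioc L Lp, ∃ w₀ : ℝ, 0 < w₀ ∧
      ∀ w : ℝ, 0 < w → w ≤ w₀ → L ≤ t - w → g (t - w) ≤ g t + B * w := by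
    intro t ht
    have htpos : 0 < t := hLpos.trans ht.1
    obtain ⟨w₀, hw₀, hw⟩ := hN₅ t ⟨ht.1.le, ht.2⟩
    set Et : ℝ := g t with hEtdef
    have hEt : 0 ≤ Et := ENNReal.toReal_nonneg
    refine ⟨min w₀ (min (t / 4) (min 1 (min (51 / (4 * Et + 1)) (52 / (816 * B₀ + 1))))),
      by positivity, fun w hw0 hwle hLtw => ?_⟩
    have hww₀ : w ≤ w₀ := hwle.trans (min_le_left _ _)
    have hwt : w ≤ t / 4 := hwle.trans ((min_le_right _ _).trans (min_le_left _ _))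
    have hw1 : w ≤ 1 :=
      hwle.trans ((min_le_right _ _).trans ((min_le_right _ _).trans (min_le_left _ _)))
    have hw51 : w ≤ 51 / (4 * Et + 1) :=
      hwle.trans ((min_le_right _ _).trans ((min_le_right _ _).trans
        ((min_le_right _ _).trans (min_le_left _ _))))
    have hw52 : w ≤ 52 / (816 * B₀ + 1) :=
      hwle.trans ((min_le_right _ _).trans ((min_le_right _ _).trans
        ((min_le_right _ _).trans (min_le_right _ _))))
    have hwE : 4 * w * Et ≤ 51 := by
      have h1 : w * (4 * Et + 1) ≤ 51 := by
        rwa [le_div_iff₀ (by positivity)] at hw51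
      nlinarith
    have hwB : 816 * w * B₀ ≤ 52 := by
      have h1 : w * (816 * B₀ + 1) ≤ 52 := by
        rwa [le_div_iff₀ (by positivity)] at hw52
      nlinarith
    obtain ⟨u, huE, hu𝓔⟩ := hw w ⟨hw0, hww₀⟩
    have h2w : 2 * w < t := by linarith
    have hsb := stub_shrinkBound v hv.1 hw0 h2w u
    -- abbreviations
    set 𝓔 : ℝ≥0∞ := ∑ j : Fin N, ∑ a : Fin 3, ∫⁻ X in {X : Config N | t - 2 * w < X j a},
        (kineticDensity u.ψ X + interaction v X * (‖u.ψ X‖₊ : ℝ≥0∞) ^ 2) with h𝓔def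
    set b : ℝ≥0∞ := ENNReal.ofReal (ε / 204 * N ^ 2 * w / (κ * sideLength ρ N ^ 3)) with hbdef
    have hbw : b = ENNReal.ofReal (B₀ * w) := by
      rw [hbdef, hB₀def]; congr 1; ring
    set X : ℝ≥0∞ := groundStateEnergy v N (t - w) with hXdef
    have hXtop : X ≠ ⊤ := hfin (t - w) hLtw
    have hEtop : groundStateEnergy v N t ≠ ⊤ := hfin t ht.1.le
    -- `X (1 - ofReal(4w²) b) ≤ E₀ t + 101 b`
    have hc_le : ENNReal.ofReal (4 * w ^ 2) * 𝓔 ≤ ENNReal.ofReal (4 * w ^ 2) * b := by gcongr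
    have h1 : X * (1 - ENNReal.ofReal (4 * w ^ 2) * b) ≤ groundStateEnergy v N t + 101 * b :=
      calc X * (1 - ENNReal.ofReal (4 * w ^ 2) * b)
          ≤ X * (1 - ENNReal.ofReal (4 * w ^ 2) * 𝓔) := by
            gcongr
        _ ≤ energy v u + 100 * 𝓔 := hsb
        _ ≤ (groundStateEnergy v N t + b) + 100 * b := by gcongr
        _ = groundStateEnergy v N t + 101 * b := by ring
    -- the correction factor as a real number
    have hcw : ENNReal.ofReal (4 * w ^ 2) * b = ENNReal.ofReal (4 * w ^ 3 * B₀) := by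
      rw [hbw, ← ENNReal.ofReal_mul (by positivity)]; congr 1; ring
    have hc1 : 4 * w ^ 3 * B₀ ≤ 1 := by
      have hw3 : w ^ 3 ≤ w := pow_le_of_le_one hw0.le hw1 three_ne_zero
      have : w ^ 3 * B₀ ≤ w * B₀ := mul_le_mul_of_nonneg_right hw3 hB₀.le
      nlinarith
    rw [hcw] at h1
    have hsub : (1 - ENNReal.ofReal (4 * w ^ 3 * B₀) : ℝ≥0∞) =
        ENNReal.ofReal (1 - 4 * w ^ 3 * B₀) := by
      rw [ENNReal.ofReal_sub _ (by positivity), ENNReal.ofReal_one]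
    rw [hsub] at h1
    -- pass to reals
    have hRtop : groundStateEnergy v N t + 101 * b ≠ ⊤ := by
      rw [hbw]; exact ENNReal.add_ne_top.2 ⟨hEtop, ENNReal.mul_ne_top (by norm_num) ENNReal.ofReal_ne_top⟩
    have h2 := ENNReal.toReal_mono hRtop h1
    rw [ENNReal.toReal_mul, ENNReal.toReal_ofReal (by linarith), ENNReal.toReal_add hEtop
      (by rw [hbw]; exact ENNReal.mul_ne_top (by norm_num) ENNReal.ofReal_ne_top),
      ENNReal.toReal_mul, hbw, ENNReal.toReal_ofReal (by positivity)] at h2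
    have h3 : X.toReal * (1 - 4 * w ^ 3 * B₀) ≤ Et + 101 * B₀ * w := by
      have : ((101 : ℝ≥0∞)).toReal = 101 := by norm_num
      rw [this] at h2
      linarith
    have h4 := slope_arith hB₀ hw0 hw1 hwE hwB h3
    -- `g (t - w) = X.toReal`, `B w = 204 B₀ w`
    show X.toReal ≤ Et + B * w
    rw [hBdef]; linarith
  -- the chain
  have key := stub_slopeChain g L Lp B hLLp hB hright hslope
  -- `B (Lp - L) = ε N / L²`
  have hBL : B * (Lp - L) = ε * N / L ^ 2 := by
    rw [hBdef, hB₀def, hLpdef]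
    field_simp
    ring
  rw [hBL] at key
  -- back to `ℝ≥0∞`
  have hLtop : groundStateEnergy v N L ≠ ⊤ := hfin L le_rfl
  have hLptop : groundStateEnergy v N Lp ≠ ⊤ := hfin Lp hLLp
  calc groundStateEnergy v N L = ENNReal.ofReal (g L) := (ENNReal.ofReal_toReal hLtop).symm
    _ ≤ ENNReal.ofReal (g Lp + ε * N / L ^ 2) := ENNReal.ofReal_le_ofReal key
    _ = groundStateEnergy v N Lp + ENNReal.ofReal (ε * N / L ^ 2) := by
        rw [ENNReal.ofReal_add ENNReal.toReal_nonneg (by positivity), ENNReal.ofReal_toReal hLptop]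

/-! ## Assembly B — the crux (sorry-free given the stubs) -/

/-- **`RigidMomentumBound` from the line** (kernel-checked; `sorry`s only inside the registered stubs):
the landed reduction `Smearing.rigidMomentumBound_of_displacementSoftness` (König's identity + rigid
smearing + S1) applied to the derived displacement softness `stub_displacementSoftness`. -/
theorem RigidMomentumBound_of : RigidMomentumBound :=
  Smearing.rigidMomentumBound_of_displacementSoftness stub_displacementSoftness

end Summit.AtomisticToContinuum.BoseEinsteinCondensation.Cruxes.RigidMomentumBound.Registered

end
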